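import Literature.MathematicalPhysics.QuantumFieldTheory.Balaban1983to89.B12WardThird415
import Literature.Analysis.Calculus.ExpDuhamel

/-!
# Bałaban CMP 109 (1987) §4 p. 283: (4.8)–(4.9) AWAY FROM `B = 0` — print's generator
`i[λ(b₋), B(b)] − g⁻¹(iad_{B(b)})(∂λ)(b)` of the gauge action in the chart `V = exp iB`, CONSTRUCTED as a closed term
for all small `B`; the fundamental Ward–Takahashi identity (4.9) FOR ALL SMALL CONFIGURATIONS from (4.7); hence
(4.10)/(4.11) at small `B ≠ 0` with print's «…» made exact, and (4.13), (4.11)|₀ BY PRINT'S OWN ROUTE, the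
coefficients `½` and `k₂ = 1/12` of `g⁻¹(z) = 1 + ½z + k₂z² + …` DERIVED as the jets of the constructed generator

CITATION HEADER (lean-in-tree rule 2026-08-18).
* Source: T. Bałaban, "Renormalization group approach to lattice gauge field theories. I. Generation of effective
  actions in a small field approximation and a coupling constant renormalization in four dimensions", Commun. Math.
  Phys. **109** (1987) 249–301, doi:10.1007/bf01215223 [Balaban1987RG1] (cell paper B12; held:
  `paper:balaban1987-cmp109-rg-i-small-field`; PDF page = journal page − 248), §4 pp. 282–284, displays (4.7),
  (4.8), (4.9), (4.10), (4.11), (4.13) and the sentences around them.  The sentences and displays quoted below were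
  READ AS IMAGES by the author of this file on the 300-dpi renders of the audit cell
  (`HOME/b2b-balaban-ref1/pages/1987-cmp109-rg-I-small-field/…-p034-x2.png` = p. 282, `…-p035-x2.png` = p. 283,
  `…-p036-x2.png` = p. 284; HOME = the cell folder `run/shared/lean/pub/pub-balaban/`), and agree with the lineage
  transcript `HOME/b2b-balaban-b03/B12s-transcript.md` and with the quotations in the headers of the lineage's
  `…B12GaugeInv47`, `…B12Semisimple414`, `…B12WardSecond415`; inside quotation marks nothing is altered.  Audit cell
  `pub-balaban`, unit `b2b-balaban-b03-g25` (PAPER SUB-CELL B03 → B12 §§2–5 lineage, gen 25), node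
  B12-GAUGE-GEN-48.  Imports the lineage head `…B12WardThird415` (gen 24; nothing of it is used by name — the import
  keeps the lineage chain linear) and through it, BY NAME ONLY: `…B12WardSecond415` (gen 22: `d³exp(0) = ⅙Σ_{S₃}`
  `iteratedFDeriv_exp_zero_three`, `iteratedFDeriv_three_apply`, the second-order chain rule at a point
  `fderiv_fderiv_comp_apply'`), `…B12Semisimple414` (gen 21: `contDiff_exp`, `d²exp(0)(a, b) = ½(ab + ba)`
  `fderiv_fderiv_exp_zero_apply`), `…B12GaugeInv47` (gen 20: (4.7) ⇒ (4.9) in the ambient coordinates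
  `fderiv_apply_gaugeGenerator_eq_zero`, the chart `contDiff_expChart`, `expChart_zero`), `…B12Ward414` (gen 5: the
  ABSTRACT Ward calculus `ward_first_order`, `ward_second_order`, `ward_first_order_eventually`,
  `ward_second_order_eventually` — «differentiations with respect to B» of an identity `Df(B)[X(B)] = 0` holding
  for `B` near `0` — and the helpers `fderiv_eval_along`, `fderiv_eval_const`); and the tree's
  `Literature.Analysis.Calculus.ExpDuhamel` (Duhamel's formula `D exp_a(h) = ∫₀¹ e^{(1−r)a} h e^{ra} dr =
  e^a ∫₀¹ e^{−ra} h e^{ra} dr`: `fderiv_exp_apply_eq_integral`, `fderiv_exp_apply_eq_exp_mul_integral`,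
  `hasDerivAt_exp_one_sub_smul`, `hasFDerivAt_exp_fderiv`, and the crude bound `norm_integral_conj_exp_sub_le`);
  Mathlib's `NormedSpace.exp`, `Ring.inverse`, `contDiffAt_ringInverse`, `Units.isOpen`, `Units.oneSub`; modifies
  nothing.
* Statements reproduced (verbatim).  p. 282 [PDF 34]: *"The tools to investigate the sum in (4.6) are provided by
  a set of Ward-Takahashi identities. They express gauge invariance of a considered function. Take a function 𝐄(V)
  defined and analytic on a domain of small gauge field configurations V on a unit lattice, and assume that it is
  gauge invariant, i.e.,"* (4.7) *"𝐄(V^v) = 𝐄(V),  V^v(b) = v(b₋)V(b)v⁻¹(b₊)."*  p. 283 [PDF 35]: *"We assume the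
  gauge invariance with respect to G^c-valued gauge transformations, but it is implied by the invariance with
  respect to G-valued transformations, and by the analyticity of the function, as it was noticed already. For a
  small gauge field V = exp iB, and a small gauge transformation v = exp iλ, B and λ small, we have"* (4.8)
  *"V^v(b) = exp iλ(b₋) exp iB(b) exp(−iλ(b₊)) = exp i(exp iad_{λ(b₋)}B(b)) exp i(λ(b₋) − λ(b₊) − ½i[λ(b₋), λ(b₊)] +
  …),  (1/i) log V^v(b) = exp iad_{λ(b₋)}B(b) + g⁻¹(iad_{exp iad_{λ(b₋)}B(b)})(λ(b₋) − λ(b₊) − …) + … = B(b) +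
  i[λ(b₋), B(b)] − g⁻¹(iad_{B(b)})(δλ)(b) + …,"* [sic: `(δλ)(b)` = the `(∂λ)(b)` of (4.9)] *"where the dots denote
  terms of higher order in λ, and g⁻¹(z) = (−z)/(e^{−z} − 1) = 1 + ½z + k₂z² + …. For more remarks about the above
  equalities and expressions see (32)–(41) [12]. Now differentiate the equality (4.7) with respect to λ, at λ = 0.
  This gives the identity"* (4.9) *"⟨(δ/δB)𝐄(exp iB), i[λ(b₋), B(b)] − g⁻¹(iad_{B(b)})(∂λ)(b)⟩ = 0 holding for all
  𝔤^c-valued functions λ, and small, 𝔤^c-valued configurations B. It is the fundamental identity expressing the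
  gauge invariance of the function 𝐄. […] We will call the identity (4.9) also the Ward-Takahashi identity. From
  this we derive a whole sequence of identities by differentiations with respect to B. For our purpose it is enough
  to consider expressions with four derivatives at most. Let us write the corresponding sequence of identities"*
  (4.10) *"⟨(δ²/δB²)𝐄(exp iB), iad_{λ₋}B − g⁻¹(iad_B)∂λ, B₁⟩ + ⟨(δ/δB)𝐄(exp iB), iad_{λ₋}B₁ − ½iad_{B₁}∂λ −
  k₂{iad_{B₁}, iad_B}∂λ − …⟩ = 0, where {A, B} = AB + BA;"* (4.11) *"⟨(δ³/δB³)𝐄(exp iB), iad_{λ₋}B − g⁻¹(iad_B)∂λ,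
  B₁, B₂⟩ + ⟨(δ²/δB²)𝐄(exp iB), iad_{λ₋}B₂ − ½iad_{B₂}∂λ − k₂{iad_{B₂}, iad_B}∂λ − …, B₁⟩ + (B₁↔B₂) +
  ⟨(δ/δB)𝐄(exp iB), −k₂{iad_{B₁}, iad_{B₂}}∂λ − …⟩ = 0,"*  p. 284 [PDF 36]: *"where the symbol (B₁↔B₂) denotes an
  expression obtained from the preceding one by the exchange of B₁ with B₂;"* […] *"We are interested in the above
  identities at B = 0, because such expressions only appear in the sum (4.6). This simplifies them in an essential
  way. Consider at first (4.10) at B = 0"* (4.13) *"⟨(δ²/δB²)𝐄(1), −∂λ, B₁⟩ + ⟨(δ/δB)𝐄(1), iad_{λ₋}B₁ −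
  ½iad_{B₁}∂λ⟩ = 0."*  And the bond convention, p. 284: *"The field B_μ(x) = B(x, x + e_μ) = […]"*.  (Inside
  quotation marks `[…]` marks an omission by the author of this file; print's own dots `…` are print's.)
* Dictionary print → Lean (the only modelling choices; all bookkeeping, no analysis) — EXACTLY the ambient typing
  of `…B12GaugeInv47` (gen 20): bonds `b = (x, x + e_ν)` of a finite additive group `T` (shifts `e : Λ → T`; `b₋ = x`,
  `b₊ = x + e_ν`), the AMBIENT gauge field `W : Λ → T → 𝔄` with values in a complete normed real algebra `𝔄` (print:
  `M_N(ℂ) ⊃ G^c`), the functional `ℰ : (Λ → T → 𝔄) → F` (print's 𝐄), «analytic» weakened to differentiable (for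
  (4.9)), `C²` (for (4.10)), `C³` (for (4.11)) NEAR `W = 1` resp. AT the configuration, the gauge action (4.7)/(4.8)
  by `v_t = exp(tΛ)`, `W ↦ (exp(tΛ(x)) W_ν(x) exp(−tΛ(x + e_ν)))_{ν,x}` (Mathlib's `NormedSpace.exp`), (4.7)
  typed locally as `∀ᶠ W near 1 (or at W = exp A), ∀ᶠ t near 0, ℰ(W^{v_t}) = ℰ(W)`; EVERY factor `i` of print is
  absorbed: print's `iB(b)` is our `A_ν(x) ∈ 𝔄`, `iλ` is `Λ : T → 𝔄`, `iad_a b = [a, b] = ab − ba`,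
  `{A, B} = AB + BA`; the chart `B ↦ (exp B_ν(x))_{ν,x}` on `𝔄`-valued bond fields (the case `ρ = id`, `V = 𝔄` of the
  `𝔤`-valued charts of gens 21–24), `(∂λ)_ν(x) = λ(x + e_ν) − λ(x)`, `λ₋ = λ(x)` on the bond `(x, x + e_ν)`;
  `⟨(δᵏ/δBᵏ)𝐄(exp iB), X, B₁, …⟩` = the `k`-th Fréchet derivative of the chart functional `f(B) = ℰ(exp B)` AT THE
  CONFIGURATION `B`, applied to the listed fields; «small, 𝔤^c-valued configurations B» = `∀ᶠ A in 𝓝 0` (qualitative) or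
  `‖A‖ < 1/15` in sup norm (quantitative, §4).  Print's `g`: from «g⁻¹(z) = (−z)/(e^{−z} − 1)»,
  `g(z) = (1 − e^{−z})/z = ∫₀¹ e^{−rz} dr`, so `g(iad_{B(b)})h = ∫₀¹ e^{−rA} h e^{rA} dr = e^{−A}·D exp_A(h)`
  (Duhamel; `integral_conj_exp_eq_exp_neg_mul_fderiv`), and **`g⁻¹(iad_{B(b)})(∂λ)(b)` is modelled by the closed term
  `Ring.inverse (D exp_{A_ν(x)}) (e^{A_ν(x)}·(∂Λ)_ν(x))`** — `Ring.inverse` in the Banach algebra `𝔄 →L[ℝ] 𝔄` of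
  bounded operators (the inverse when `D exp_A` is a unit, which it is for `A` near `0`,
  `isUnit_fderiv_exp_eventually`, and whenever `‖A‖ < 1/15`, `isUnit_fderiv_exp_of_norm_lt`; it then solves print's
  equation `g(iad_A)z = ∂Λ` uniquely, `integral_conj_exp_inverse_apply`, `eq_inverse_apply_of_integral_conj_exp_eq`).
  So print's test field of (4.9)–(4.12), the GENERATOR FIELD, is the lambda `X_Λ(A) = (Λ(x)A_ν(x) − A_ν(x)Λ(x) −
  Ring.inverse (D exp_{A_ν(x)}) (e^{A_ν(x)}(Λ(x + e_ν) − Λ(x))))_{ν,x}`, written out in every statement: the module is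
  DEFINITION-FREE.  The `ℚ`-algebra structure assumed by the tree's Duhamel file is supplied INSIDE proofs
  (`NormedAlgebra.restrictScalars ℚ ℝ 𝔄`); statements carry only `[NormedRing 𝔄] [NormedAlgebra ℝ 𝔄]
  [CompleteSpace 𝔄]`.  AMBIENT-TYPING CAVEAT (as in the lineage): `ℰ` is asked to be differentiable / `C²` / `C³`
  and gauge invariant as a function of the AMBIENT `𝔄`-valued field near `1` (hypothesis strengthening only).
* The mathematics (print's «Now differentiate the equality (4.7) with respect to λ, at λ = 0» done AT `B ≠ 0`, the
  place where print only points to «(32)–(41) [12]»).  (i) For `a, y ∈ 𝔄`: `D exp_a(ya − ay) = y e^a − e^a y` (the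
  fundamental theorem of calculus for `r ↦ e^{(1−r)a} y e^{ra}` inside Duhamel's integral) and `D exp_a(z) =
  e^a·g(ad_a)z`; hence if `g(ad_A)Z = ∂Λ` bondwise, `D exp_A([Λ₋, A] − Z) = Λ₋e^A − e^AΛ₋ − e^A∂Λ = Λ₋e^A − e^AΛ₊`,
  the AMBIENT generator of (4.7) at `W = e^A`, on which `Dℰ(e^A)` vanishes (gen 20, the `t`-derivative of (4.7) at
  `t = 0`); by the chain rule through the chart at `A` this is (4.9) at the configuration `A` — print's (4.8) to first
  order in `λ` is exactly the statement that the chart vector `i[λ₋, B] − g⁻¹(iad_B)∂λ` exponentiates to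
  `v₋ V v₊⁻¹`, and `log` is never needed.  (ii) `g(ad_a) = e^{−a}·D exp_a` is within `15‖a‖` of the identity in
  operator norm (`‖a‖ ≤ 1`), so a unit for `‖a‖ < 1/15`; units are open and `a ↦ D exp_a` is continuous, so
  `D exp_{A(b)}` is a unit at every bond for `A` near `0`, and there inversion is analytic: `X_Λ` is `C^∞` near `0`.
  (iii) The jets of `ζ(a) = g⁻¹(ad_a)y = (D exp_a)⁻¹(e^a y)` at `0`: differentiating the identity `D exp_a(ζ(a)) =
  e^a y` (valid near `0`) once and twice at `a = 0` with `d²exp(0)(u, v) = ½(uv + vu)`, `d³exp(0) = ⅙Σ_{S₃}`: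
  `ζ(0) = y`, `Dζ(0)u = ½[u, y]`, `D²ζ(0)(u, v) = (1/12)([u, [v, y]] + [v, [u, y]]) = k₂{ad_u, ad_v}y` — i.e.
  `g⁻¹(z) = 1 + ½z + (1/12)z² + …` is RECOVERED by the kernel from `1/2!`, `1/3!` (the residual identity
  `secondJet_residual_eq` by `noncomm_ring`), so `X_Λ(0) = −∂Λ`, `DX_Λ(0)B₁ = [Λ₋, B₁] − ½[B₁, ∂Λ]`,
  `D²X_Λ(0)(B₁, B₂) = −(1/12){ad_{B₁}, ad_{B₂}}∂Λ` — print's «iad_{λ₋}B₁ − ½iad_{B₁}∂λ − k₂{iad_{B₁}, iad_B}∂λ − …»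
  and «−k₂{iad_{B₁}, iad_{B₂}}∂λ − …» at `B = 0`.  (iv) Feeding `hinv : ∀ᶠ A near 0, Df(A)[X_Λ(A)] = 0` and the
  smoothness of `X_Λ` into gen 5's abstract calculus gives (4.10) and (4.11) AT EVERY SMALL CONFIGURATION with
  print's dots EXACT (the full first / second derivative of `X_Λ` at `A`), and at `A = 0`, substituting the jets,
  (4.13) and (4.11)|₀ with `½` and `k₂ = 1/12` — the same identities gens 21/22 obtained in the ambient coordinates
  (`hessian_one_apply_grad_eq`, `third_one_apply_grad_eq`, where `½`, `1/12` came from the Taylor coefficients of the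
  chart); here they come, as in print, from `g⁻¹`.

WHAT IS PROVED (kernel-checked, no `sorry`, standard axioms, NO definitions; every analytic input on `ℰ` a NAMED
HYPOTHESIS):
* §1 [folklore] `fderiv_exp_apply_commutator` (`D exp_a(ya − ay) = y e^a − e^a y`), `fderiv_exp_apply_chartGenerator`
  (`g(ad_a)z = Λ₊ − Λ₋ ⇒ D exp_a([Λ₋, a] − z) = Λ₋e^a − e^aΛ₊`: the third line of (4.8) bondwise),
  `integral_conj_exp_eq_exp_neg_mul_fderiv` (`g(ad_a) = e^{−a}·D exp_a`),
  `integral_conj_exp_inverse_apply`, `eq_inverse_apply_of_integral_conj_exp_eq` (the closed term solves print's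
  equation, uniquely).
* §2 [folklore] `hasFDerivAt_expChart`, `fderiv_expChart_apply`, `fderiv_comp_expChart_apply` (the chart and the
  chart functional differentiated at an ARBITRARY configuration).
* §3 **(4.7) ⇒ (4.9) AT A CONFIGURATION `B ≠ 0`**: `fderiv_chart_apply_generator_eq_zero` (for any solution `Z` of
  `g(iad_B)Z = ∂λ`), `fderiv_chart_apply_gaugeGen_eq_zero` (for the closed term, given invertibility at every bond):
  `D(ℰ∘exp)(A)[X_Λ(A)] = 0`.
* §4 [folklore] `fderiv_exp_zero`, `isUnit_fderiv_exp_eventually`, `isUnit_fderiv_exp_of_norm_lt` («small» made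
  quantitative: `‖a‖ < 1/15`), `isUnit_fderiv_exp_eventually_pi`.
* §5 **(4.9) FOR ALL SMALL CONFIGURATIONS**: `fderiv_chart_apply_gaugeGen_eq_zero_of_norm_lt` (every `A` with
  `‖A‖ < 1/15`), `fderiv_chart_apply_gaugeGen_eq_zero_eventually` (= the hypothesis `hinv` of `…B12Ward414`, from
  (4.7) near `1`); smoothness `contDiffAt_inverse_fderiv_exp_apply`, `contDiffAt_gaugeGen`,
  `contDiffAt_gaugeGen_zero`, `contDiffAt_gaugeGen_eventually`; `gaugeGen_zero` (`X_Λ(0) = −∂Λ`).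
* §6 the FIRST JET [folklore about (4.8)/(4.10)]: `inverse_fderiv_exp_apply_zero`,
  `fderiv_inverse_fderiv_exp_apply_zero` (`Dζ(0)u = ½[u, y]` — the `½` of `g⁻¹`), `hasFDerivAt_gaugeGen_zero`,
  `fderiv_gaugeGen_zero_apply` (`DX_Λ(0)B₁ = [Λ₋, B₁] − ½[B₁, ∂Λ]`).
* §7 the SECOND JET [folklore about (4.8)/(4.10)/(4.11)]: `fderiv_fderiv_sub_apply`, `clm_fderiv_fderiv_comp_apply`,
  `fderiv_fderiv_comp_clm_apply` (second-order calculus helpers), `secondJet_residual_eq`,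
  `fderiv_exp_apply_fderiv_inverse_eventuallyEq` (the differentiated defining identity near `0`),
  `fderiv_fderiv_fderiv_exp_zero_apply`, `fderiv_fderiv_inverse_fderiv_exp_apply_zero` (`D²ζ(0)(u, v) =
  (1/12)([u,[v,y]] + [v,[u,y]])` — **`k₂ = 1/12` DERIVED**), `fderiv_fderiv_gaugeGen_zero_apply`
  (`D²X_Λ(0)(B₁, B₂) = −(1/12){ad_{B₁}, ad_{B₂}}∂Λ`).
* §8 **print's route**: `ward_first_order_gaugeGen_eventually` — (4.10) AT EVERY SMALL `B`;
  `ward_first_order_gaugeGen_zero` — (4.13); `ward_second_order_gaugeGen_eventually` — (4.11) AT EVERY SMALL `B`;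
  `ward_second_order_gaugeGen_zero` — (4.11) at `B = 0` with all three jets substituted (`k₂ = 1/12`).

WHAT IS NOT PROVED HERE (and not claimed): (4.8) as a statement about `(1/i) log V^v` (no logarithm is used or
constructed: the first-order-in-`λ` term of (4.8) is constructed and its defining property — it exponentiates to
`v₋Vv₊⁻¹` to first order — is proved; the terms «…» of higher order in `λ` and the BCH remarks «(32)–(41) [12]» are
not modelled); (4.12) at `B ≠ 0` (one more derivative of `X_Λ`; same method, not done); the `𝔤`-valued typing with a
representation `ρ : V →L[ℝ] 𝔄` of gens 21–24 (here `ρ = id`: a `ρ`-version needs `g⁻¹(ad)` to preserve `ρ(V)`, i.e. a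
Lie-closed `V`); the `G → G^c` extension «by the analyticity of the function»; (4.14), semisimplicity and the
(4.15) family (gens 20–24); existence, analyticity and gauge invariance of print's `𝐄^{(j)}`; nothing about B13 or
the continuum limit.  The constant `1/15` is the tree's crude Duhamel bound, not print's.

HONEST FRAMING: value = typed skeleton / kernel certificate of a printed construction + identity: the lineage's
standing caveat «(4.10)–(4.12) AWAY from `B = 0` (the `B`-dependent generator `i[λ₋, B] − g⁻¹(iad_B)∂λ`, i.e.
`d log` away from `0`, is not constructed in the lineage)» (headers of gens 21–24) is discharged for (4.9)–(4.11):
print's generator is a closed Lean term, smooth near `0`, (4.9) holds at every small configuration as print states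
it, and print's coefficients `½`, `k₂ = 1/12` are now the kernel-computed jets of that term (agreeing with the values
gens 21–24 found by the ambient route).  NOT summit progress: bookkeeping of printed displays; every analytic
statement about `𝐄` remains a hypothesis.
-/

namespace Literature.MathematicalPhysics.QuantumFieldTheory.Balaban1983to89.B12GaugeGen48

open Literature.Analysis.Calculus (hasDerivAt_exp_one_sub_smul fderiv_exp_apply_eq_integral
  fderiv_exp_apply_eq_exp_mul_integral hasFDerivAt_exp_fderiv norm_integral_conj_exp_sub_le)
open Literature.MathematicalPhysics.QuantumFieldTheory.Balaban1983to89.B12GaugeInv47 (contDiff_expChart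
  fderiv_apply_gaugeGenerator_eq_zero expChart_zero)
open Literature.MathematicalPhysics.QuantumFieldTheory.Balaban1983to89.B12WardSecond415 (iteratedFDeriv_three_apply
  iteratedFDeriv_exp_zero_three fderiv_fderiv_comp_apply')
open Literature.MathematicalPhysics.QuantumFieldTheory.Balaban1983to89.B12Semisimple414 (contDiff_exp
  fderiv_fderiv_exp_zero_apply)
open Literature.MathematicalPhysics.QuantumFieldTheory.Balaban1983to89.B12Ward414 (ward_first_order ward_second_order
  fderiv_eval_along fderiv_eval_const ward_first_order_eventually ward_second_order_eventually)
open NormedSpace (exp exp_zero exp_add_of_commute)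
open Filter MeasureTheory
open _root_.Topology

/-! ## §1. The derivative of the exponential on commutators, and print's `g(iad_B) = ∫₀¹ e^{−r·iad_B} dr` -/

section ExpCommutator

variable {𝔄 : Type*} [NormedRing 𝔄] [NormedAlgebra ℝ 𝔄] [CompleteSpace 𝔄]

/-- **`D exp_a(ya − ay) = y·e^a − e^a·y`**: the derivative of the exponential at `a` on the commutator `[y, a]` is
the commutator `[y, e^a]` — the `t`-derivative at `0` of `exp(e^{ty} a e^{−ty}) = e^{ty} e^a e^{−ty}`, here obtained
from Duhamel's formula `D exp_a(h) = ∫₀¹ e^{(1−r)a} h e^{ra} dr` (tree `Literature.Analysis.Calculus.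
fderiv_exp_apply_eq_integral`, by name) and the fundamental theorem of calculus for `r ↦ e^{(1−r)a} y e^{ra}`.
(The second line of (4.8): the part `exp iad_{λ(b₋)}B(b)` of `(1/i) log V^v(b)` exponentiates to
`v(b₋) (exp iB(b)) v(b₋)⁻¹`.) [folklore] -/
theorem fderiv_exp_apply_commutator (a y : 𝔄) : fderiv ℝ exp a (y * a - a * y) = y * exp a - exp a * y := by
  letI : NormedAlgebra ℚ 𝔄 := NormedAlgebra.restrictScalars ℚ ℝ 𝔄
  have hF : ∀ r : ℝ, HasDerivAt (fun r : ℝ => exp ((1 - r) • a) * y * exp (r • a))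
      (exp ((1 - r) • a) * (y * a - a * y) * exp (r • a)) r := by
    intro r
    have h := ((hasDerivAt_exp_one_sub_smul a r).mul_const y).fun_mul
      (hasDerivAt_exp_smul_const' (𝕂 := ℝ) a r)
    have heq : -(exp ((1 - r) • a) * a) * y * exp (r • a) + exp ((1 - r) • a) * y * (a * exp (r • a)) =
        exp ((1 - r) • a) * (y * a - a * y) * exp (r • a) := by
      noncomm_ring
    rw [heq] at h
    exact h
  have hcont : Continuous fun r : ℝ => exp ((1 - r) • a) * (y * a - a * y) * exp (r • a) := by fun_prop
  rw [fderiv_exp_apply_eq_integral,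
    intervalIntegral.integral_eq_sub_of_hasDerivAt (fun r _ => hF r) (hcont.intervalIntegrable 0 1)]
  simp [exp_zero]

/-- **The third line of (4.8), bondwise**: if `z` solves `∫₀¹ e^{−ra} z e^{ra} dr = Λ₊ − Λ₋` (print:
`z = g⁻¹(iad_B)(∂λ)`, `g(w) = (1 − e^{−w})/w = ∫₀¹ e^{−rw} dr`, so that `g(iad_B) = ∫₀¹ Ad(e^{−irB}) dr`), then the
chart vector `[Λ₋, a] − z` is pushed forward by `D exp_a` to the ambient generator `Λ₋ e^a − e^a Λ₊` of the gauge
action `v₋ V v₊⁻¹` at `V = e^a` (Duhamel: `D exp_a(z) = e^a ∫₀¹ e^{−ra} z e^{ra} dr`, tree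
`fderiv_exp_apply_eq_exp_mul_integral`, by name). [cite: Balaban1987RG1, (4.8) p.283] -/
theorem fderiv_exp_apply_chartGenerator (a Lm Lp z : 𝔄)
    (hz : ∫ r in (0 : ℝ)..1, exp (-(r • a)) * z * exp (r • a) = Lp - Lm) :
    fderiv ℝ exp a (Lm * a - a * Lm - z) = Lm * exp a - exp a * Lp := by
  letI : NormedAlgebra ℚ 𝔄 := NormedAlgebra.restrictScalars ℚ ℝ 𝔄
  rw [map_sub, fderiv_exp_apply_commutator, fderiv_exp_apply_eq_exp_mul_integral, hz]
  noncomm_ring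

/-- `exp(−a)·exp(a) = 1`. [folklore]  (Private copy over `[NormedAlgebra ℝ 𝔄]`: the landed
`Literature.Analysis.Complex.exp_neg_mul_exp` is stated over `[NormedAlgebra ℚ 𝔄]` inside the Runge-approximation
module `Literature/Analysis/Complex/RungeBoxes.lean`, whose import into the Bałaban chain is not wanted.) -/
private theorem exp_neg_mul_exp (a : 𝔄) : exp (-a) * exp a = 1 := by
  letI : NormedAlgebra ℚ 𝔄 := NormedAlgebra.restrictScalars ℚ ℝ 𝔄
  rw [← exp_add_of_commute (Commute.refl a).neg_left, neg_add_cancel, exp_zero]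

/-- `exp(a)·exp(−a) = 1`. [folklore]  (Private copy, as above; landed twin
`Literature.Analysis.Complex.exp_mul_exp_neg`.) -/
private theorem exp_mul_exp_neg (a : 𝔄) : exp a * exp (-a) = 1 := by
  letI : NormedAlgebra ℚ 𝔄 := NormedAlgebra.restrictScalars ℚ ℝ 𝔄
  rw [← exp_add_of_commute (Commute.refl a).neg_right, add_neg_cancel, exp_zero]

/-- **Print's `g(iad_B)` is `e^{−iB}·D exp_{iB}`**: `∫₀¹ e^{−ra} h e^{ra} dr = e^{−a}·D exp_a(h)` (Duhamel).  In
particular `z = g⁻¹(iad_B)(y)` means `D exp_a(z) = e^a y`. [folklore] (about (4.8) p.283 of Balaban1987RG1) -/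
theorem integral_conj_exp_eq_exp_neg_mul_fderiv (a h : 𝔄) :
    ∫ r in (0 : ℝ)..1, exp (-(r • a)) * h * exp (r • a) = exp (-a) * fderiv ℝ exp a h := by
  letI : NormedAlgebra ℚ 𝔄 := NormedAlgebra.restrictScalars ℚ ℝ 𝔄
  rw [fderiv_exp_apply_eq_exp_mul_integral, ← mul_assoc, exp_neg_mul_exp, one_mul]

/-- **`g⁻¹(iad_B)(y)` as a closed term**: when `D exp_a` is invertible (it is for small `a`, §4), the vector
`z := (D exp_a)⁻¹(e^a y)` solves print's equation `g(iad_a) z = y`, i.e. `∫₀¹ e^{−ra} z e^{ra} dr = y`.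
[folklore] (about (4.8) p.283 of Balaban1987RG1) -/
theorem integral_conj_exp_inverse_apply (a y : 𝔄) (ha : IsUnit (fderiv ℝ exp a)) :
    ∫ r in (0 : ℝ)..1, exp (-(r • a)) * (Ring.inverse (fderiv ℝ exp a) (exp a * y)) * exp (r • a) = y := by
  rw [integral_conj_exp_eq_exp_neg_mul_fderiv, ← mul_apply_eq_comp, Ring.mul_inverse_cancel _ ha,
    one_apply_eq_self, ← mul_assoc, exp_neg_mul_exp, one_mul]

/-- Uniqueness: `∫₀¹ e^{−ra} z e^{ra} dr = y` forces `z = (D exp_a)⁻¹(e^a y)` when `D exp_a` is invertible.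
[folklore] -/
theorem eq_inverse_apply_of_integral_conj_exp_eq (a y z : 𝔄) (ha : IsUnit (fderiv ℝ exp a))
    (hz : ∫ r in (0 : ℝ)..1, exp (-(r • a)) * z * exp (r • a) = y) :
    z = Ring.inverse (fderiv ℝ exp a) (exp a * y) := by
  have h1 : fderiv ℝ exp a z = exp a * y := by
    rw [← hz, integral_conj_exp_eq_exp_neg_mul_fderiv, ← mul_assoc, exp_mul_exp_neg, one_mul]
  rw [← h1, ← mul_apply_eq_comp, Ring.inverse_mul_cancel _ ha, one_apply_eq_self]

end ExpCommutator

/-! ## §2. The exponential chart on bond fields and its derivative at an arbitrary configuration -/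

section Chart

variable {𝔄 : Type*} [NormedRing 𝔄] [NormedAlgebra ℝ 𝔄] [CompleteSpace 𝔄] {Λ T : Type*} [Fintype Λ] [Fintype T]

/-- **`D(exp iB)|_B[U] = (D exp_{iB(b)} U(b))_b`**: the derivative of the chart `B ↦ (exp B_ν(x))_{ν,x}` at ANY
configuration is bondwise the derivative of the exponential. [folklore] -/
theorem hasFDerivAt_expChart (A : Λ → T → 𝔄) :
    HasFDerivAt (fun B : Λ → T → 𝔄 => fun ν x => exp (B ν x))
      (ContinuousLinearMap.pi fun ν => ContinuousLinearMap.pi fun x =>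
        (fderiv ℝ exp (A ν x)).comp ((ContinuousLinearMap.proj (R := ℝ) (φ := fun _ : T => 𝔄) x).comp
          (ContinuousLinearMap.proj (R := ℝ) (φ := fun _ : Λ => T → 𝔄) ν))) A := by
  refine hasFDerivAt_pi'.2 fun ν => hasFDerivAt_pi'.2 fun x => ?_
  have he : HasFDerivAt (fun B : Λ → T → 𝔄 => B ν x)
      ((ContinuousLinearMap.proj (R := ℝ) (φ := fun _ : T => 𝔄) x).comp
        (ContinuousLinearMap.proj (R := ℝ) (φ := fun _ : Λ => T → 𝔄) ν)) A :=
    ((ContinuousLinearMap.proj (R := ℝ) (φ := fun _ : T => 𝔄) x).comp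
      (ContinuousLinearMap.proj (R := ℝ) (φ := fun _ : Λ => T → 𝔄) ν)).hasFDerivAt
  have hexp : HasFDerivAt (exp : 𝔄 → 𝔄) (fderiv ℝ exp (A ν x)) ((fun B : Λ → T → 𝔄 => B ν x) A) :=
    hasFDerivAt_exp_fderiv (A ν x)
  have h := hexp.comp A he
  refine (h.congr_fderiv ?_ : HasFDerivAt (fun B : Λ → T → 𝔄 => exp (B ν x)) _ A)
  ext B
  simp

/-- `D(exp iB)|_A[U] = (D exp_{A(b)} U(b))_b`, as an equation. [folklore] -/
theorem fderiv_expChart_apply (A U : Λ → T → 𝔄) :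
    fderiv ℝ (fun B : Λ → T → 𝔄 => fun ν x => exp (B ν x)) A U = fun ν x => fderiv ℝ exp (A ν x) (U ν x) := by
  rw [(hasFDerivAt_expChart A).fderiv]
  funext ν x
  simp

variable {F : Type*} [NormedAddCommGroup F] [NormedSpace ℝ F]

/-- **Chain rule for the chart functional at an arbitrary configuration**: `D(𝐄∘exp)(A)[U] =
D𝐄(exp A)[(D exp_{A(b)} U(b))_b]`. [folklore] -/
theorem fderiv_comp_expChart_apply {ℰ : (Λ → T → 𝔄) → F} (A U : Λ → T → 𝔄)
    (hℰ : DifferentiableAt ℝ ℰ (fun ν x => exp (A ν x))) :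
    fderiv ℝ (fun B : Λ → T → 𝔄 => ℰ (fun ν x => exp (B ν x))) A U =
      fderiv ℝ ℰ (fun ν x => exp (A ν x)) (fun ν x => fderiv ℝ exp (A ν x) (U ν x)) := by
  have h := hℰ.hasFDerivAt.comp A (hasFDerivAt_expChart A)
  rw [show (fun B : Λ → T → 𝔄 => ℰ (fun ν x => exp (B ν x))) = ℰ ∘ (fun B : Λ → T → 𝔄 => fun ν x => exp (B ν x))
    from rfl, h.fderiv, ← fderiv_expChart_apply A U, (hasFDerivAt_expChart A).fderiv]
  rfl

end Chart

/-! ## §3. (4.9) at a configuration `B ≠ 0`: `⟨(δ/δB)𝐄(exp iB), i[λ(b₋), B(b)] − g⁻¹(iad_{B(b)})(∂λ)(b)⟩ = 0` -/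

section FourNine

variable {𝔄 : Type*} [NormedRing 𝔄] [NormedAlgebra ℝ 𝔄] [CompleteSpace 𝔄] {Λ T : Type*} [Fintype Λ] [Fintype T]
  [AddCommGroup T] {F : Type*} [NormedAddCommGroup F] [NormedSpace ℝ F]

/-- **(4.9) at an arbitrary (small) configuration, print's generator** (p. 283 «Now differentiate the equality (4.7)
with respect to λ, at λ = 0. This gives the identity ⟨(δ/δB)𝐄(exp iB), i[λ(b₋), B(b)] − g⁻¹(iad_{B(b)})(∂λ)(b)⟩ = 0
holding for all 𝔤^c-valued functions λ, and small, 𝔤^c-valued configurations B. It is the fundamental identity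
expressing the gauge invariance of the function 𝐄.»): if `𝐄` is differentiable at `exp A` and gauge invariant (4.7)
there for small `t`, and `Z` is print's `g⁻¹(iad_A)(∂Λ)` — i.e. solves `∫₀¹ e^{−rA(b)} Z(b) e^{rA(b)} dr = (∂Λ)(b)`
bondwise — then `D(𝐄∘exp)(A)[[Λ₋, A] − Z] = 0`.  Proof = print's: the chart vector is `D exp_A`-pushed to the ambient
generator `Λ₋e^A − e^AΛ₊` (`fderiv_exp_apply_chartGenerator`), on which `D𝐄(exp A)` vanishes by (4.7) differentiated
at `λ = 0` (`…B12GaugeInv47.fderiv_apply_gaugeGenerator_eq_zero`, by name).  Smallness of `A` is needed only for the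
EXISTENCE of `Z` (§4). [cite: Balaban1987RG1, (4.7) p.282, (4.8)-(4.9) p.283] -/
theorem fderiv_chart_apply_generator_eq_zero {ℰ : (Λ → T → 𝔄) → F} (e : Λ → T) (Lam : T → 𝔄)
    (A Z : Λ → T → 𝔄) (hℰ : DifferentiableAt ℝ ℰ (fun ν x => exp (A ν x)))
    (h47 : ∀ᶠ t in 𝓝 (0 : ℝ), ℰ (fun ν x => exp (t • Lam x) * exp (A ν x) * exp (-(t • Lam (x + e ν)))) =
      ℰ (fun ν x => exp (A ν x)))
    (hZ : ∀ ν x, ∫ r in (0 : ℝ)..1, exp (-(r • A ν x)) * Z ν x * exp (r • A ν x) = Lam (x + e ν) - Lam x) :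
    fderiv ℝ (fun B : Λ → T → 𝔄 => ℰ (fun ν x => exp (B ν x))) A
      (fun ν x => Lam x * A ν x - A ν x * Lam x - Z ν x) = 0 := by
  rw [fderiv_comp_expChart_apply A _ hℰ]
  have hgen : (fun ν x => fderiv ℝ exp (A ν x) (Lam x * A ν x - A ν x * Lam x - Z ν x)) =
      fun ν x => Lam x * exp (A ν x) - exp (A ν x) * Lam (x + e ν) := by
    funext ν x
    exact fderiv_exp_apply_chartGenerator _ _ _ _ (hZ ν x)
  rw [hgen]
  exact fderiv_apply_gaugeGenerator_eq_zero e Lam hℰ h47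

/-- **(4.9) at a configuration, with print's generator as the CLOSED TERM `[Λ₋, A] − (D exp_A)⁻¹(e^A ∂Λ)`** (the
inverse taken in the Banach algebra of bounded operators on `𝔄`, bondwise; it is `g⁻¹(iad_A)(∂Λ)` whenever
`D exp_{A(b)}` is invertible, `integral_conj_exp_inverse_apply`). [cite: Balaban1987RG1, (4.7) p.282, (4.8)-(4.9)
p.283] -/
theorem fderiv_chart_apply_gaugeGen_eq_zero {ℰ : (Λ → T → 𝔄) → F} (e : Λ → T) (Lam : T → 𝔄)
    (A : Λ → T → 𝔄) (hA : ∀ ν x, IsUnit (fderiv ℝ exp (A ν x)))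
    (hℰ : DifferentiableAt ℝ ℰ (fun ν x => exp (A ν x)))
    (h47 : ∀ᶠ t in 𝓝 (0 : ℝ), ℰ (fun ν x => exp (t • Lam x) * exp (A ν x) * exp (-(t • Lam (x + e ν)))) =
      ℰ (fun ν x => exp (A ν x))) :
    fderiv ℝ (fun B : Λ → T → 𝔄 => ℰ (fun ν x => exp (B ν x))) A
      (fun ν x => Lam x * A ν x - A ν x * Lam x -
        Ring.inverse (fderiv ℝ exp (A ν x)) (exp (A ν x) * (Lam (x + e ν) - Lam x))) = 0 :=
  fderiv_chart_apply_generator_eq_zero e Lam A _ hℰ h47 fun ν x => integral_conj_exp_inverse_apply _ _ (hA ν x)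

end FourNine


/-! ## §4. «B and λ small»: `D exp_{iB(b)}` — equivalently `g(iad_{B(b)})` — is invertible for small `B` -/

section Small

variable {𝔄 : Type*} [NormedRing 𝔄] [NormedAlgebra ℝ 𝔄] [CompleteSpace 𝔄]

/-- `D exp_0 = id` (the first line of (4.8) to first order). [folklore] -/
theorem fderiv_exp_zero : fderiv ℝ exp (0 : 𝔄) = 1 := (hasFDerivAt_exp_zero (𝕂 := ℝ)).fderiv

/-- **For small `a`, `D exp_a` is invertible** (units of the Banach algebra of bounded operators on `𝔄` are open and
`a ↦ D exp_a` is continuous with `D exp_0 = 1`); hence print's `g⁻¹(iad_B)` exists for «small» `B`. [folklore]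
(about (4.8) p.283 of Balaban1987RG1) -/
theorem isUnit_fderiv_exp_eventually : ∀ᶠ a in 𝓝 (0 : 𝔄), IsUnit (fderiv ℝ exp a) := by
  have hc : ContinuousAt (fderiv ℝ (exp : 𝔄 → 𝔄)) 0 :=
    ((contDiff_exp (𝔄 := 𝔄) (n := 1)).continuous_fderiv one_ne_zero).continuousAt
  have hmem : {L : 𝔄 →L[ℝ] 𝔄 | IsUnit L} ∈ 𝓝 (fderiv ℝ (exp : 𝔄 → 𝔄) 0) := by
    refine Units.isOpen.mem_nhds ?_
    rw [Set.mem_setOf_eq, fderiv_exp_zero]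
    exact isUnit_one
  exact hc.preimage_mem_nhds hmem

/-- **«Small» made QUANTITATIVE: `‖a‖ < 1/15` suffices** for `D exp_a` to be invertible — `e^{−a}·D exp_a =
g(ad_a) = ∫₀¹ e^{−r ad_a} dr` is within `15‖a‖ < 1` of the identity in operator norm
(`Literature.Analysis.Calculus.norm_integral_conj_exp_sub_le`), hence a unit, and `D exp_a = e^{a}·g(ad_a)`.
[folklore] (about (4.8) p.283 «small … configurations B» of Balaban1987RG1; the constant `1/15` is the tree's
crude Duhamel bound, not print's) -/
theorem isUnit_fderiv_exp_of_norm_lt (a : 𝔄) (ha : ‖a‖ < 1 / 15) : IsUnit (fderiv ℝ exp a) := by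
  letI : NormedAlgebra ℚ 𝔄 := NormedAlgebra.restrictScalars ℚ ℝ 𝔄
  have ha1 : ‖a‖ ≤ 1 := ha.le.trans (by norm_num)
  -- `G = e^{-a}·D exp_a = g(ad_a)` as a bounded operator
  set G : 𝔄 →L[ℝ] 𝔄 := (ContinuousLinearMap.mul ℝ 𝔄 (exp (-a))).comp (fderiv ℝ exp a) with hG
  have hG1 : ‖1 - G‖ < 1 := by
    have hle : ‖1 - G‖ ≤ 15 * ‖a‖ := by
      refine ContinuousLinearMap.opNorm_le_bound _ (by positivity) fun h => ?_
      have hGh : G h = ∫ r in (0 : ℝ)..1, exp (-(r • a)) * h * exp (r • a) := by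
        rw [integral_conj_exp_eq_exp_neg_mul_fderiv]
        simp [hG]
      rw [sub_apply, one_apply_eq_self, hGh, norm_sub_rev]
      exact norm_integral_conj_exp_sub_le a h ha1
    calc ‖1 - G‖ ≤ 15 * ‖a‖ := hle
      _ < 15 * (1 / 15) := by gcongr
      _ = 1 := by norm_num
  have hUG : IsUnit G := by
    have h := (Units.oneSub (1 - G) hG1).isUnit
    rwa [Units.val_oneSub, sub_sub_cancel] at h
  -- left multiplication by `e^{a}` is a unit of the operator algebra, with inverse left multiplication by `e^{-a}`
  have hE : IsUnit (ContinuousLinearMap.mul ℝ 𝔄 (exp a)) := by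
    refine ⟨⟨ContinuousLinearMap.mul ℝ 𝔄 (exp a), ContinuousLinearMap.mul ℝ 𝔄 (exp (-a)), ?_, ?_⟩, rfl⟩
    · ext h
      simp [← mul_assoc, exp_mul_exp_neg a]
    · ext h
      simp [← mul_assoc, exp_neg_mul_exp a]
  have hfac : fderiv ℝ exp a = ContinuousLinearMap.mul ℝ 𝔄 (exp a) * G := by
    ext h
    simp [hG, ← mul_assoc, exp_mul_exp_neg a]
  rw [hfac]
  exact hE.mul hUG

variable {Λ T : Type*} [Finite Λ] [Finite T]

/-- The same on bond fields: for `A` near `0`, every `D exp_{A(b)}` is invertible. [folklore] -/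
theorem isUnit_fderiv_exp_eventually_pi :
    ∀ᶠ A in 𝓝 (0 : Λ → T → 𝔄), ∀ ν x, IsUnit (fderiv ℝ exp (A ν x)) := by
  refine eventually_all.2 fun ν => eventually_all.2 fun x => ?_
  have hc : Continuous fun A : Λ → T → 𝔄 => A ν x := by fun_prop
  have ht : Tendsto (fun A : Λ → T → 𝔄 => A ν x) (𝓝 0) (𝓝 0) := by simpa using hc.tendsto 0
  exact ht.eventually isUnit_fderiv_exp_eventually

end Small

/-! ## §5. The generator FIELD `B ↦ i[λ₋, B] − g⁻¹(iad_B)∂λ` near `B = 0`: (4.9) for all small `B`, smoothness -/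

section Generator

variable {𝔄 : Type*} [NormedRing 𝔄] [NormedAlgebra ℝ 𝔄] [CompleteSpace 𝔄] {Λ T : Type*} [Fintype Λ] [Fintype T]
  [AddCommGroup T] {F : Type*} [NormedAddCommGroup F] [NormedSpace ℝ F]

/-- **(4.9) at every configuration of sup-norm `< 1/15`** («small» made quantitative): if `‖A‖ < 1/15`, `𝐄` is
differentiable at `exp A` and gauge invariant (4.7) there for small `t`, then `D(𝐄 ∘ exp)(A)[X_λ(A)] = 0`
(`isUnit_fderiv_exp_of_norm_lt` at every bond + `fderiv_chart_apply_gaugeGen_eq_zero`). [cite: Balaban1987RG1,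
(4.7) p.282, (4.8)-(4.9) p.283] -/
theorem fderiv_chart_apply_gaugeGen_eq_zero_of_norm_lt {ℰ : (Λ → T → 𝔄) → F} (e : Λ → T) (Lam : T → 𝔄)
    (A : Λ → T → 𝔄) (hA : ‖A‖ < 1 / 15) (hℰ : DifferentiableAt ℝ ℰ (fun ν x => exp (A ν x)))
    (h47 : ∀ᶠ t in 𝓝 (0 : ℝ), ℰ (fun ν x => exp (t • Lam x) * exp (A ν x) * exp (-(t • Lam (x + e ν)))) =
      ℰ (fun ν x => exp (A ν x))) :
    fderiv ℝ (fun B : Λ → T → 𝔄 => ℰ (fun ν x => exp (B ν x))) A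
      (fun ν x => Lam x * A ν x - A ν x * Lam x -
        Ring.inverse (fderiv ℝ exp (A ν x)) (exp (A ν x) * (Lam (x + e ν) - Lam x))) = 0 :=
  fderiv_chart_apply_gaugeGen_eq_zero e Lam A
    (fun ν x => isUnit_fderiv_exp_of_norm_lt _ (((norm_le_pi_norm (A ν) x).trans (norm_le_pi_norm A ν)).trans_lt hA))
    hℰ h47

/-- **(4.9) FOR ALL SMALL CONFIGURATIONS — the hypothesis `hinv` of the abstract Ward calculus `…B12Ward414`**
(p. 283 (4.9) «… holding for all 𝔤^c-valued functions λ, and small, 𝔤^c-valued configurations B.»): if `𝐄` is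
differentiable near `V = 1` and gauge invariant (4.7) near `V = 1` for small `t`, then for every configuration `A`
near `0` the derivative of the chart functional `B ↦ 𝐄(exp iB)` at `A` kills print's generator
`X_λ(A) = ([Λ₋, A(b)] − (D exp_{A(b)})⁻¹(e^{A(b)} (∂Λ)(b)))_b = (i[λ₋, B] − g⁻¹(iad_B)∂λ)(b)`.
[cite: Balaban1987RG1, (4.7) p.282, (4.8)-(4.9) p.283] -/
theorem fderiv_chart_apply_gaugeGen_eq_zero_eventually {ℰ : (Λ → T → 𝔄) → F} (e : Λ → T) (Lam : T → 𝔄)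
    (hℰ : ∀ᶠ W in 𝓝 (1 : Λ → T → 𝔄), DifferentiableAt ℝ ℰ W)
    (h47 : ∀ᶠ W in 𝓝 (1 : Λ → T → 𝔄), ∀ᶠ t in 𝓝 (0 : ℝ),
      ℰ (fun ν x => exp (t • Lam x) * W ν x * exp (-(t • Lam (x + e ν)))) = ℰ W) :
    ∀ᶠ A in 𝓝 (0 : Λ → T → 𝔄), fderiv ℝ (fun B : Λ → T → 𝔄 => ℰ (fun ν x => exp (B ν x))) A
      (fun ν x => Lam x * A ν x - A ν x * Lam x -
        Ring.inverse (fderiv ℝ exp (A ν x)) (exp (A ν x) * (Lam (x + e ν) - Lam x))) = 0 := by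
  have hc : Tendsto (fun B : Λ → T → 𝔄 => fun ν x => exp (B ν x)) (𝓝 0) (𝓝 1) := by
    have h := (contDiff_expChart (𝔄 := 𝔄) (Λ := Λ) (T := T) (n := 0)).continuous.tendsto 0
    rwa [expChart_zero] at h
  filter_upwards [isUnit_fderiv_exp_eventually_pi, hc.eventually hℰ, hc.eventually h47] with A hA hℰA h47A
  exact fderiv_chart_apply_gaugeGen_eq_zero e Lam A hA hℰA h47A

omit [Fintype Λ] [Fintype T] [AddCommGroup T] in
/-- The scalar generator map `a ↦ (D exp_a)⁻¹(e^a y) = g⁻¹(iad_a) y` is smooth wherever `D exp_a` is invertible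
(inversion is analytic on the units of a Banach algebra, Mathlib `contDiffAt_ringInverse`). [folklore] -/
theorem contDiffAt_inverse_fderiv_exp_apply {n : WithTop ℕ∞} {a : 𝔄} (ha : IsUnit (fderiv ℝ exp a)) (y : 𝔄) :
    ContDiffAt ℝ n (fun b : 𝔄 => Ring.inverse (fderiv ℝ exp b) (exp b * y)) a := by
  obtain ⟨u, hu⟩ := ha
  have h1 : ContDiffAt ℝ n (fun b : 𝔄 => Ring.inverse (fderiv ℝ exp b)) a := by
    have hT : ContDiffAt ℝ n (fderiv ℝ (exp : 𝔄 → 𝔄)) a :=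
      ((contDiff_exp (𝔄 := 𝔄) (n := n + 1)).fderiv_right le_rfl).contDiffAt
    have hI : ContDiffAt ℝ n Ring.inverse (fderiv ℝ (exp : 𝔄 → 𝔄) a) := by
      rw [← hu]
      exact contDiffAt_ringInverse ℝ u
    exact hI.comp a hT
  have h2 : ContDiffAt ℝ n (fun b : 𝔄 => exp b * y) a := contDiff_exp.contDiffAt.mul contDiffAt_const
  exact h1.clm_apply h2

/-- **The generator field is smooth** at every configuration where all `D exp_{A(b)}` are invertible (in particular
near `0`, `isUnit_fderiv_exp_eventually_pi`): print's «…» in (4.8)/(4.10)/(4.11) are the Taylor expansions of a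
genuinely smooth field. [folklore] (about (4.8)-(4.11) p.283 of Balaban1987RG1) -/
theorem contDiffAt_gaugeGen {n : WithTop ℕ∞} (e : Λ → T) (Lam : T → 𝔄) {A : Λ → T → 𝔄}
    (hA : ∀ ν x, IsUnit (fderiv ℝ exp (A ν x))) :
    ContDiffAt ℝ n (fun B : Λ → T → 𝔄 => fun ν x => Lam x * B ν x - B ν x * Lam x -
      Ring.inverse (fderiv ℝ exp (B ν x)) (exp (B ν x) * (Lam (x + e ν) - Lam x))) A := by
  refine contDiffAt_pi.2 fun ν => contDiffAt_pi.2 fun x => ?_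
  have hev : ContDiffAt ℝ n (fun B : Λ → T → 𝔄 => B ν x) A := (contDiff_apply_apply ℝ 𝔄 ν x).contDiffAt
  have hζ : ContDiffAt ℝ n (fun B : Λ → T → 𝔄 =>
      Ring.inverse (fderiv ℝ exp (B ν x)) (exp (B ν x) * (Lam (x + e ν) - Lam x))) A :=
    (contDiffAt_inverse_fderiv_exp_apply (n := n) (hA ν x) (Lam (x + e ν) - Lam x)).comp
      (f := fun B : Λ → T → 𝔄 => B ν x) A hev
  exact ((contDiffAt_const.mul hev).sub (hev.mul contDiffAt_const)).sub hζ

/-- The generator field is smooth at `B = 0`. [folklore] -/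
theorem contDiffAt_gaugeGen_zero {n : WithTop ℕ∞} (e : Λ → T) (Lam : T → 𝔄) :
    ContDiffAt ℝ n (fun B : Λ → T → 𝔄 => fun ν x => Lam x * B ν x - B ν x * Lam x -
      Ring.inverse (fderiv ℝ exp (B ν x)) (exp (B ν x) * (Lam (x + e ν) - Lam x))) 0 :=
  contDiffAt_gaugeGen e Lam fun ν x => by
    rw [Pi.zero_apply, Pi.zero_apply, fderiv_exp_zero]
    exact isUnit_one

/-- The generator field is smooth at every configuration near `0` (feeds `…B12Ward414.ward_first_order_eventually`
/ `ward_second_order_eventually`, i.e. (4.10)/(4.11) AT `B ≠ 0`). [folklore] -/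
theorem contDiffAt_gaugeGen_eventually {n : WithTop ℕ∞} (e : Λ → T) (Lam : T → 𝔄) :
    ∀ᶠ A in 𝓝 (0 : Λ → T → 𝔄), ContDiffAt ℝ n (fun B : Λ → T → 𝔄 => fun ν x => Lam x * B ν x - B ν x * Lam x -
      Ring.inverse (fderiv ℝ exp (B ν x)) (exp (B ν x) * (Lam (x + e ν) - Lam x))) A :=
  isUnit_fderiv_exp_eventually_pi.mono fun _ hA => contDiffAt_gaugeGen e Lam hA

omit [Fintype Λ] [Fintype T] in
/-- **`X_λ(0) = −∂λ`** (the generator at the unit configuration: (4.8) at `B = 0`, `g⁻¹(0) = 1`; print's (4.13)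
«⟨(δ²/δB²)𝐄(1), −∂λ, B₁⟩ + …»). [cite: Balaban1987RG1, (4.8) p.283, (4.13) p.284] -/
theorem gaugeGen_zero (e : Λ → T) (Lam : T → 𝔄) :
    (fun ν x => Lam x * (0 : Λ → T → 𝔄) ν x - (0 : Λ → T → 𝔄) ν x * Lam x -
      Ring.inverse (fderiv ℝ exp ((0 : Λ → T → 𝔄) ν x)) (exp ((0 : Λ → T → 𝔄) ν x) * (Lam (x + e ν) - Lam x))) =
      fun ν x => -(Lam (x + e ν) - Lam x) := by
  funext ν x
  simp [fderiv_exp_zero, exp_zero]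

end Generator

/-! ## §6. The first jet of the generator at `B = 0`: the `½` of `g⁻¹(z) = 1 + ½z + k₂z² + …` —
`DX_λ(0)B₁ = i[λ₋, B₁] − ½i[B₁, ∂λ]` -/

section FirstJet

variable {𝔄 : Type*} [NormedRing 𝔄] [NormedAlgebra ℝ 𝔄] [CompleteSpace 𝔄]

/-- The scalar generator map at `0`: `(D exp_0)⁻¹(e^0 y) = y` (`g⁻¹(0) = 1`). [folklore] -/
theorem inverse_fderiv_exp_apply_zero (y : 𝔄) :
    Ring.inverse (fderiv ℝ exp (0 : 𝔄)) (exp (0 : 𝔄) * y) = y := by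
  simp [fderiv_exp_zero, exp_zero]

/-- **The coefficient `½` of `g⁻¹(z) = 1 + ½z + …` as an OUTPUT**: the derivative at `a = 0` of print's
`a ↦ g⁻¹(ad_a) y = (D exp_a)⁻¹(e^a y)` is `u ↦ ½[u, y]`.  Proof: differentiate the identity
`D exp_a((D exp_a)⁻¹(e^a y)) = e^a y` (valid near `0`, §4) at `a = 0` with the product rule
(`…B12Ward414.fderiv_eval_along`) and use `d²exp(0)(u, y) = ½(uy + yu)` (`…B12Semisimple414.
fderiv_fderiv_exp_zero_apply`): `½(uy + yu) + D(…)(0)u = uy`. [folklore] (about (4.8) p.283 «g⁻¹(z) = (−z)/(e^{−z} −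
1) = 1 + ½z + k₂z² + …» of Balaban1987RG1) -/
theorem fderiv_inverse_fderiv_exp_apply_zero (y u : 𝔄) :
    fderiv ℝ (fun b : 𝔄 => Ring.inverse (fderiv ℝ exp b) (exp b * y)) 0 u = (2 : ℝ)⁻¹ • (u * y - y * u) := by
  have hId : (fun b : 𝔄 => fderiv ℝ exp b (Ring.inverse (fderiv ℝ exp b) (exp b * y))) =ᶠ[𝓝 0]
      fun b => exp b * y := by
    filter_upwards [isUnit_fderiv_exp_eventually] with b hb
    rw [← mul_apply_eq_comp, Ring.mul_inverse_cancel _ hb, one_apply_eq_self]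
  have hT : DifferentiableAt ℝ (fderiv ℝ (exp : 𝔄 → 𝔄)) 0 :=
    (((contDiff_exp (𝔄 := 𝔄) (n := 2)).fderiv_right (m := 1) le_rfl).differentiable (by simp)).differentiableAt
  have hζ : DifferentiableAt ℝ (fun b : 𝔄 => Ring.inverse (fderiv ℝ exp b) (exp b * y)) 0 :=
    (contDiffAt_inverse_fderiv_exp_apply (n := 1) (by rw [fderiv_exp_zero]; exact isUnit_one) y).differentiableAt
      (by simp)
  have hL := fderiv_eval_along (A := fderiv ℝ (exp : 𝔄 → 𝔄))
    (Y := fun b : 𝔄 => Ring.inverse (fderiv ℝ exp b) (exp b * y)) hT hζ u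
  have hR : fderiv ℝ (fun b : 𝔄 => exp b * y) 0 u = u * y := by
    rw [fderiv_mul_const' ((contDiff_exp (𝔄 := 𝔄) (n := 1)).differentiable (by simp)).differentiableAt,
      fderiv_exp_zero]
    simp
  have h := congrArg (fun φ : 𝔄 →L[ℝ] 𝔄 => φ u) hId.fderiv_eq
  rw [hL, hR, inverse_fderiv_exp_apply_zero, fderiv_exp_zero, one_apply_eq_self, fderiv_fderiv_exp_zero_apply] at h
  rw [eq_sub_of_add_eq h]
  module

end FirstJet

section FirstJetField

variable {𝔄 : Type*} [NormedRing 𝔄] [NormedAlgebra ℝ 𝔄] [CompleteSpace 𝔄] {Λ T : Type*} [Fintype Λ] [Fintype T]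
  [AddCommGroup T]

/-- **The derivative of the generator field at `B = 0`**, as a continuous linear map (bondwise
`B₁ ↦ [Λ₋, B₁(b)] − D(g⁻¹(iad_·)(∂Λ)(b))(0)B₁(b)`). [folklore] -/
theorem hasFDerivAt_gaugeGen_zero (e : Λ → T) (Lam : T → 𝔄) :
    HasFDerivAt (fun B : Λ → T → 𝔄 => fun ν x => Lam x * B ν x - B ν x * Lam x -
        Ring.inverse (fderiv ℝ exp (B ν x)) (exp (B ν x) * (Lam (x + e ν) - Lam x)))
      (ContinuousLinearMap.pi fun ν => ContinuousLinearMap.pi fun x =>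
        Lam x • ((ContinuousLinearMap.proj (R := ℝ) (φ := fun _ : T => 𝔄) x).comp
            (ContinuousLinearMap.proj (R := ℝ) (φ := fun _ : Λ => T → 𝔄) ν)) -
          MulOpposite.op (Lam x) • ((ContinuousLinearMap.proj (R := ℝ) (φ := fun _ : T => 𝔄) x).comp
            (ContinuousLinearMap.proj (R := ℝ) (φ := fun _ : Λ => T → 𝔄) ν)) -
          (fderiv ℝ (fun b : 𝔄 => Ring.inverse (fderiv ℝ exp b) (exp b * (Lam (x + e ν) - Lam x))) 0).comp
            ((ContinuousLinearMap.proj (R := ℝ) (φ := fun _ : T => 𝔄) x).comp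
              (ContinuousLinearMap.proj (R := ℝ) (φ := fun _ : Λ => T → 𝔄) ν))) 0 := by
  refine hasFDerivAt_pi'.2 fun ν => hasFDerivAt_pi'.2 fun x => ?_
  have he : HasFDerivAt (fun B : Λ → T → 𝔄 => B ν x)
      ((ContinuousLinearMap.proj (R := ℝ) (φ := fun _ : T => 𝔄) x).comp
        (ContinuousLinearMap.proj (R := ℝ) (φ := fun _ : Λ => T → 𝔄) ν)) 0 :=
    ((ContinuousLinearMap.proj (R := ℝ) (φ := fun _ : T => 𝔄) x).comp
      (ContinuousLinearMap.proj (R := ℝ) (φ := fun _ : Λ => T → 𝔄) ν)).hasFDerivAt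
  have hζ : HasFDerivAt (fun b : 𝔄 => Ring.inverse (fderiv ℝ exp b) (exp b * (Lam (x + e ν) - Lam x)))
      (fderiv ℝ (fun b : 𝔄 => Ring.inverse (fderiv ℝ exp b) (exp b * (Lam (x + e ν) - Lam x))) 0)
      ((fun B : Λ → T → 𝔄 => B ν x) 0) :=
    ((contDiffAt_inverse_fderiv_exp_apply (n := 1) (by rw [fderiv_exp_zero]; exact isUnit_one)
      (Lam (x + e ν) - Lam x)).differentiableAt (by simp)).hasFDerivAt
  have h := ((he.const_mul (Lam x)).sub (he.mul_const' (Lam x))).sub (hζ.comp 0 he)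
  refine (h.congr_fderiv ?_ : HasFDerivAt (fun B : Λ → T → 𝔄 => Lam x * B ν x - B ν x * Lam x -
    Ring.inverse (fderiv ℝ exp (B ν x)) (exp (B ν x) * (Lam (x + e ν) - Lam x))) _ 0)
  ext B
  simp

/-- **`DX_λ(0)B₁ = i[λ₋, B₁] − ½i[B₁, ∂λ]` — the second slot of (4.13), with the coefficient `½` DERIVED** (p. 283
(4.10) «⟨(δ/δB)𝐄(exp iB), iad_{λ₋}B₁ − ½iad_{B₁}∂λ − k₂{iad_{B₁}, iad_B}∂λ − …⟩» at `B = 0`, p. 284 (4.13)):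
`DX_λ(0)U = ([Λ₋, U(b)] − ½[U(b), (∂Λ)(b)])_b`. [cite: Balaban1987RG1, (4.8)/(4.10) p.283, (4.13) p.284] -/
theorem fderiv_gaugeGen_zero_apply (e : Λ → T) (Lam : T → 𝔄) (U : Λ → T → 𝔄) :
    fderiv ℝ (fun B : Λ → T → 𝔄 => fun ν x => Lam x * B ν x - B ν x * Lam x -
        Ring.inverse (fderiv ℝ exp (B ν x)) (exp (B ν x) * (Lam (x + e ν) - Lam x))) 0 U =
      fun ν x => Lam x * U ν x - U ν x * Lam x -
        (2 : ℝ)⁻¹ • (U ν x * (Lam (x + e ν) - Lam x) - (Lam (x + e ν) - Lam x) * U ν x) := by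
  rw [(hasFDerivAt_gaugeGen_zero e Lam).fderiv]
  funext ν x
  simp [fderiv_inverse_fderiv_exp_apply_zero]

end FirstJetField

/-! ## §7. The second jet of the generator at `B = 0`: `k₂ = 1/12` — `D²X_λ(0)(B₁, B₂) =
−k₂{iad_{B₁}, iad_{B₂}}∂λ` -/

section ChainHelpers

variable {E G H : Type*} [NormedAddCommGroup E] [NormedSpace ℝ E] [NormedAddCommGroup G] [NormedSpace ℝ G]
  [NormedAddCommGroup H] [NormedSpace ℝ H]

/-- `D²(f − g)(z)(u, v) = D²f(z)(u, v) − D²g(z)(u, v)` for `f, g` of class `C²` at `z`. [folklore] -/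
theorem fderiv_fderiv_sub_apply {f g : E → G} {z : E} (hf : ContDiffAt ℝ 2 f z) (hg : ContDiffAt ℝ 2 g z)
    (u v : E) :
    fderiv ℝ (fderiv ℝ (fun w => f w - g w)) z u v = fderiv ℝ (fderiv ℝ f) z u v - fderiv ℝ (fderiv ℝ g) z u v := by
  have hf' : ∀ᶠ w in 𝓝 z, DifferentiableAt ℝ f w :=
    (hf.eventually (by simp)).mono fun w hw => hw.differentiableAt (by simp)
  have hg' : ∀ᶠ w in 𝓝 z, DifferentiableAt ℝ g w :=
    (hg.eventually (by simp)).mono fun w hw => hw.differentiableAt (by simp)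
  have h1 : fderiv ℝ (fun w => f w - g w) =ᶠ[𝓝 z] fun w => fderiv ℝ f w - fderiv ℝ g w := by
    filter_upwards [hf', hg'] with w hfw hgw
    exact fderiv_fun_sub hfw hgw
  rw [h1.fderiv_eq, fderiv_fun_sub ((hf.fderiv_right (m := 1) (by norm_num)).differentiableAt (by simp))
    ((hg.fderiv_right (m := 1) (by norm_num)).differentiableAt (by simp))]
  rfl

/-- `D²(ev ∘ X)(z)(U, V) = ev(D²X(z)(U, V))` for a continuous linear `ev` and `X` of class `C²` at `z`
(`…B12WardSecond415.fderiv_fderiv_comp_apply'`). [folklore] -/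
theorem clm_fderiv_fderiv_comp_apply (ev : G →L[ℝ] H) {X : E → G} {z : E} (hX : ContDiffAt ℝ 2 X z)
    (U V : E) : fderiv ℝ (fderiv ℝ (fun B => ev (X B))) z U V = ev (fderiv ℝ (fderiv ℝ X) z U V) := by
  rw [fderiv_fderiv_comp_apply' (𝕜 := ℝ) hX ev.contDiff.contDiffAt U V,
    show fderiv ℝ (⇑ev) = fun _ => ev from funext fun _ => ev.fderiv]
  simp

/-- `D²(ζ ∘ L)(z)(U, V) = D²ζ(Lz)(LU, LV)` for a continuous linear `L` and `ζ` of class `C²` at `L z`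
(`…B12WardSecond415.fderiv_fderiv_comp_apply'`). [folklore] -/
theorem fderiv_fderiv_comp_clm_apply {ζ : G → H} (L : E →L[ℝ] G) {z : E} (hζ : ContDiffAt ℝ 2 ζ (L z))
    (U V : E) : fderiv ℝ (fderiv ℝ (fun B => ζ (L B))) z U V = fderiv ℝ (fderiv ℝ ζ) (L z) (L U) (L V) := by
  rw [fderiv_fderiv_comp_apply' (𝕜 := ℝ) L.contDiff.contDiffAt hζ U V,
    show fderiv ℝ (⇑L) = fun _ => L from funext fun _ => L.fderiv]
  simp

end ChainHelpers

section SecondJet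

variable {𝔄 : Type*} [NormedRing 𝔄] [NormedAlgebra ℝ 𝔄] [CompleteSpace 𝔄]

omit [CompleteSpace 𝔄] in
/-- Cancelling a non-zero real scalar. [folklore] -/
private theorem eq_of_smul_eq' {c : ℝ} (hc : c ≠ 0) {a b : 𝔄} (h : c • a = c • b) : a = b := by
  rw [← inv_smul_smul₀ hc a, ← inv_smul_smul₀ hc b, h]

omit [CompleteSpace 𝔄] in
/-- The free-algebra identity behind `k₂ = 1/12`: `½(vu + uv)y − ½(u·½[v,y] + ½[v,y]·u) − ⅙Σ_{S₃}(v,u,y) −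
½(v·½[u,y] + ½[u,y]·v) = (1/12)([u,[v,y]] + [v,[u,y]])`. [folklore] -/
theorem secondJet_residual_eq (u v y : 𝔄) :
    (2 : ℝ)⁻¹ • (v * u + u * v) * y
      - (2 : ℝ)⁻¹ • (u * ((2 : ℝ)⁻¹ • (v * y - y * v)) + (2 : ℝ)⁻¹ • (v * y - y * v) * u)
      - (6 : ℝ)⁻¹ • (v * u * y + v * y * u + u * v * y + u * y * v + y * v * u + y * u * v)
      - (2 : ℝ)⁻¹ • (v * ((2 : ℝ)⁻¹ • (u * y - y * u)) + (2 : ℝ)⁻¹ • (u * y - y * u) * v) =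
      (12 : ℝ)⁻¹ • ((u * (v * y - y * v) - (v * y - y * v) * u) + (v * (u * y - y * u) - (u * y - y * u) * v)) := by
  have h12 : (12 : ℝ) ≠ 0 := by norm_num
  apply eq_of_smul_eq' h12
  simp only [smul_add, smul_sub, add_mul, mul_sub, sub_mul, mul_smul_comm, smul_mul_assoc, smul_smul,
    smul_inv_smul₀ h12]
  norm_num
  simp only [ofNat_smul_eq_nsmul]
  noncomm_ring

/-- **The first-order identity for `ζ(a) = g⁻¹(ad_a)y` NEAR `0`**: differentiating `D exp_a(ζ(a)) = e^a y` (valid on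
the open set where `D exp_a` is invertible, §4) gives `D exp_a(Dζ(a)u) = (D exp_a u)·y − d²exp(a)(u, ζ(a))`
for all `a` near `0`. [folklore] -/
theorem fderiv_exp_apply_fderiv_inverse_eventuallyEq (y u : 𝔄) :
    (fun b : 𝔄 => fderiv ℝ exp b (fderiv ℝ (fun b : 𝔄 => Ring.inverse (fderiv ℝ exp b) (exp b * y)) b u))
      =ᶠ[𝓝 0] fun b => fderiv ℝ exp b u * y -
        fderiv ℝ (fderiv ℝ exp) b u (Ring.inverse (fderiv ℝ exp b) (exp b * y)) := by
  have hT1 : ContDiff ℝ 1 (fderiv ℝ (exp : 𝔄 → 𝔄)) := (contDiff_exp (n := 2)).fderiv_right (m := 1) (by norm_num)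
  filter_upwards [(isUnit_fderiv_exp_eventually (𝔄 := 𝔄)).eventually_nhds] with b hb
  have hbU : IsUnit (fderiv ℝ exp b) := hb.self_of_nhds
  have hId : (fun b' : 𝔄 => fderiv ℝ exp b' (Ring.inverse (fderiv ℝ exp b') (exp b' * y))) =ᶠ[𝓝 b]
      fun b' => exp b' * y := by
    filter_upwards [hb] with b' hb'
    rw [← mul_apply_eq_comp, Ring.mul_inverse_cancel _ hb', one_apply_eq_self]
  have hT : DifferentiableAt ℝ (fderiv ℝ (exp : 𝔄 → 𝔄)) b := (hT1.differentiable (by simp)).differentiableAt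
  have hζ : DifferentiableAt ℝ (fun b' : 𝔄 => Ring.inverse (fderiv ℝ exp b') (exp b' * y)) b :=
    (contDiffAt_inverse_fderiv_exp_apply (n := 1) hbU y).differentiableAt (by simp)
  have hL := fderiv_eval_along (A := fderiv ℝ (exp : 𝔄 → 𝔄))
    (Y := fun b' : 𝔄 => Ring.inverse (fderiv ℝ exp b') (exp b' * y)) hT hζ u
  have hR : fderiv ℝ (fun b' : 𝔄 => exp b' * y) b u = fderiv ℝ exp b u * y := by
    rw [fderiv_mul_const' ((contDiff_exp (𝔄 := 𝔄) (n := 1)).differentiable (by simp)).differentiableAt]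
    simp
  have h := congrArg (fun φ : 𝔄 →L[ℝ] 𝔄 => φ u) hId.fderiv_eq
  rw [hL, hR] at h
  exact eq_sub_of_add_eq h

/-- `d³exp(0)(v, u, y)` in curried form (`…B12WardSecond415.iteratedFDeriv_exp_zero_three`). [folklore] -/
theorem fderiv_fderiv_fderiv_exp_zero_apply (v u y : 𝔄) :
    fderiv ℝ (fderiv ℝ (fderiv ℝ (exp : 𝔄 → 𝔄))) 0 v u y =
      (6 : ℝ)⁻¹ • (v * u * y + v * y * u + u * v * y + u * y * v + y * v * u + y * u * v) := by
  have h := iteratedFDeriv_exp_zero_three (𝔄 := 𝔄) ![v, u, y]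
  rw [iteratedFDeriv_three_apply] at h
  simpa using h

/-- **The coefficient `k₂ = 1/12` of `g⁻¹(z) = 1 + ½z + k₂z² + …` as an OUTPUT**: the second derivative at `a = 0`
of print's `a ↦ g⁻¹(ad_a)y = (D exp_a)⁻¹(e^a y)` is `(u, v) ↦ (1/12)([u, [v, y]] + [v, [u, y]]) =
k₂{ad_u, ad_v}y` (p. 283 (4.10) «− k₂{iad_{B₁}, iad_B}∂λ − …»; `k₂ = B₂/2! = 1/12`).  Proof: differentiate the
first-order identity (`fderiv_exp_apply_fderiv_inverse_eventuallyEq`) once more at `0` and evaluate with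
`d²exp(0)(a, b) = ½(ab + ba)`, `d³exp(0) = ⅙Σ_{S₃}`, `Dζ(0)w = ½[w, y]`; the residual is
`secondJet_residual_eq`. [folklore] (about (4.8)/(4.10) p.283 of Balaban1987RG1) -/
theorem fderiv_fderiv_inverse_fderiv_exp_apply_zero (y u v : 𝔄) :
    fderiv ℝ (fderiv ℝ (fun b : 𝔄 => Ring.inverse (fderiv ℝ exp b) (exp b * y))) 0 v u =
      (12 : ℝ)⁻¹ • ((u * (v * y - y * v) - (v * y - y * v) * u) + (v * (u * y - y * u) - (u * y - y * u) * v)) := by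
  have h0 : IsUnit (fderiv ℝ exp (0 : 𝔄)) := by rw [fderiv_exp_zero]; exact isUnit_one
  -- differentiability at `0`
  have hT : DifferentiableAt ℝ (fderiv ℝ (exp : 𝔄 → 𝔄)) 0 :=
    (((contDiff_exp (𝔄 := 𝔄) (n := 2)).fderiv_right (m := 1) (by norm_num)).differentiable
      (by simp)).differentiableAt
  have hT2 : DifferentiableAt ℝ (fderiv ℝ (fderiv ℝ (exp : 𝔄 → 𝔄))) 0 :=
    ((((contDiff_exp (𝔄 := 𝔄) (n := 3)).fderiv_right (m := 2) (by norm_num)).fderiv_right (m := 1)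
      (by norm_num)).differentiable (by simp)).differentiableAt
  have hζ2 : ContDiffAt ℝ 2 (fun b : 𝔄 => Ring.inverse (fderiv ℝ exp b) (exp b * y)) 0 :=
    contDiffAt_inverse_fderiv_exp_apply (n := 2) h0 y
  have hζ : DifferentiableAt ℝ (fun b : 𝔄 => Ring.inverse (fderiv ℝ exp b) (exp b * y)) 0 :=
    hζ2.differentiableAt (by simp)
  have hζ' : DifferentiableAt ℝ (fderiv ℝ (fun b : 𝔄 => Ring.inverse (fderiv ℝ exp b) (exp b * y))) 0 :=
    (hζ2.fderiv_right (m := 1) (by norm_num)).differentiableAt (by simp)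
  -- the left-hand side of the differentiated identity
  have hL : fderiv ℝ (fun b : 𝔄 => fderiv ℝ exp b
      (fderiv ℝ (fun b : 𝔄 => Ring.inverse (fderiv ℝ exp b) (exp b * y)) b u)) 0 v =
      fderiv ℝ exp 0 (fderiv ℝ (fderiv ℝ (fun b : 𝔄 => Ring.inverse (fderiv ℝ exp b) (exp b * y))) 0 v u) +
        fderiv ℝ (fderiv ℝ exp) 0 v
          (fderiv ℝ (fun b : 𝔄 => Ring.inverse (fderiv ℝ exp b) (exp b * y)) 0 u) := by
    rw [fderiv_eval_along (A := fderiv ℝ (exp : 𝔄 → 𝔄)) hT (hζ'.clm_apply (differentiableAt_const u)) v,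
      fderiv_eval_const hζ' u v]
  -- the two terms of the right-hand side
  have hd1 : DifferentiableAt ℝ (fun b : 𝔄 => fderiv ℝ exp b u * y) 0 :=
    (hT.clm_apply (differentiableAt_const u)).mul_const y
  have hd2 : DifferentiableAt ℝ (fun b : 𝔄 => fderiv ℝ (fderiv ℝ exp) b u
      (Ring.inverse (fderiv ℝ exp b) (exp b * y))) 0 :=
    (hT2.clm_apply (differentiableAt_const u)).clm_apply hζ
  have hR1 : fderiv ℝ (fun b : 𝔄 => fderiv ℝ exp b u * y) 0 v = fderiv ℝ (fderiv ℝ exp) 0 v u * y := by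
    rw [fderiv_mul_const' (hT.clm_apply (differentiableAt_const u))]
    simp [fderiv_eval_const hT u v]
  have hR2 : fderiv ℝ (fun b : 𝔄 => fderiv ℝ (fderiv ℝ exp) b u
      (Ring.inverse (fderiv ℝ exp b) (exp b * y))) 0 v =
      fderiv ℝ (fderiv ℝ exp) 0 u (fderiv ℝ (fun b : 𝔄 => Ring.inverse (fderiv ℝ exp b) (exp b * y)) 0 v) +
        fderiv ℝ (fderiv ℝ (fderiv ℝ exp)) 0 v u (Ring.inverse (fderiv ℝ exp (0 : 𝔄)) (exp (0 : 𝔄) * y)) := by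
    rw [fderiv_eval_along (A := fun b : 𝔄 => fderiv ℝ (fderiv ℝ exp) b u) (hT2.clm_apply (differentiableAt_const u))
      hζ v, fderiv_eval_const hT2 u v]
  have hR : fderiv ℝ (fun b : 𝔄 => fderiv ℝ exp b u * y -
      fderiv ℝ (fderiv ℝ exp) b u (Ring.inverse (fderiv ℝ exp b) (exp b * y))) 0 v =
      fderiv ℝ (fderiv ℝ exp) 0 v u * y -
        (fderiv ℝ (fderiv ℝ exp) 0 u (fderiv ℝ (fun b : 𝔄 => Ring.inverse (fderiv ℝ exp b) (exp b * y)) 0 v) +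
          fderiv ℝ (fderiv ℝ (fderiv ℝ exp)) 0 v u (Ring.inverse (fderiv ℝ exp (0 : 𝔄)) (exp (0 : 𝔄) * y))) := by
    rw [fderiv_fun_sub hd1 hd2, ← hR1, ← hR2]
    rfl
  -- differentiate the first-order identity
  have h := congrArg (fun φ : 𝔄 →L[ℝ] 𝔄 => φ v) (fderiv_exp_apply_fderiv_inverse_eventuallyEq y u).fderiv_eq
  rw [hL, hR, inverse_fderiv_exp_apply_zero, fderiv_exp_zero, one_apply_eq_self,
    fderiv_inverse_fderiv_exp_apply_zero, fderiv_inverse_fderiv_exp_apply_zero, fderiv_fderiv_exp_zero_apply,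
    fderiv_fderiv_exp_zero_apply, fderiv_fderiv_exp_zero_apply, fderiv_fderiv_fderiv_exp_zero_apply] at h
  rw [eq_sub_of_add_eq h, ← secondJet_residual_eq u v y]
  abel

end SecondJet

section SecondJetField

variable {𝔄 : Type*} [NormedRing 𝔄] [NormedAlgebra ℝ 𝔄] [CompleteSpace 𝔄] {Λ T : Type*} [Fintype Λ] [Fintype T]
  [AddCommGroup T]

/-- **`D²X_λ(0)(B₁, B₂) = −k₂{iad_{B₁}, iad_{B₂}}∂λ` with `k₂ = 1/12` DERIVED** (p. 283 (4.10)/(4.11)): the second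
derivative at `B = 0` of the generator field is, bondwise, `−(1/12)([V(b), [U(b), ∂Λ(b)]] + [U(b), [V(b), ∂Λ(b)]])`
(through the evaluation maps and the scalar jet `fderiv_fderiv_inverse_fderiv_exp_apply_zero`).
[cite: Balaban1987RG1, (4.8)/(4.10) p.283] -/
theorem fderiv_fderiv_gaugeGen_zero_apply (e : Λ → T) (Lam : T → 𝔄) (U V : Λ → T → 𝔄) :
    fderiv ℝ (fderiv ℝ (fun B : Λ → T → 𝔄 => fun ν x => Lam x * B ν x - B ν x * Lam x -
        Ring.inverse (fderiv ℝ exp (B ν x)) (exp (B ν x) * (Lam (x + e ν) - Lam x)))) 0 U V =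
      fun ν x => -((12 : ℝ)⁻¹ • ((V ν x * (U ν x * (Lam (x + e ν) - Lam x) - (Lam (x + e ν) - Lam x) * U ν x) -
          (U ν x * (Lam (x + e ν) - Lam x) - (Lam (x + e ν) - Lam x) * U ν x) * V ν x) +
        (U ν x * (V ν x * (Lam (x + e ν) - Lam x) - (Lam (x + e ν) - Lam x) * V ν x) -
          (V ν x * (Lam (x + e ν) - Lam x) - (Lam (x + e ν) - Lam x) * V ν x) * U ν x))) := by
  funext ν x
  -- the bond evaluation `ev`
  set ev : (Λ → T → 𝔄) →L[ℝ] 𝔄 := (ContinuousLinearMap.proj (R := ℝ) (φ := fun _ : T => 𝔄) x).comp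
    (ContinuousLinearMap.proj (R := ℝ) (φ := fun _ : Λ => T → 𝔄) ν) with hev
  have hX2 : ContDiffAt ℝ 2 (fun B : Λ → T → 𝔄 => fun ν x => Lam x * B ν x - B ν x * Lam x -
      Ring.inverse (fderiv ℝ exp (B ν x)) (exp (B ν x) * (Lam (x + e ν) - Lam x))) 0 :=
    contDiffAt_gaugeGen_zero (n := 2) e Lam
  -- pass to the component `(ν, x)`
  have hcomp : fderiv ℝ (fderiv ℝ (fun B : Λ → T → 𝔄 => fun ν x => Lam x * B ν x - B ν x * Lam x -
      Ring.inverse (fderiv ℝ exp (B ν x)) (exp (B ν x) * (Lam (x + e ν) - Lam x)))) 0 U V ν x =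
      fderiv ℝ (fderiv ℝ (fun B : Λ → T → 𝔄 => (Lam x * ev B - ev B * Lam x) -
        Ring.inverse (fderiv ℝ exp (ev B)) (exp (ev B) * (Lam (x + e ν) - Lam x)))) 0 U V := by
    rw [show fderiv ℝ (fderiv ℝ (fun B : Λ → T → 𝔄 => fun ν x => Lam x * B ν x - B ν x * Lam x -
        Ring.inverse (fderiv ℝ exp (B ν x)) (exp (B ν x) * (Lam (x + e ν) - Lam x)))) 0 U V ν x =
        ev (fderiv ℝ (fderiv ℝ (fun B : Λ → T → 𝔄 => fun ν x => Lam x * B ν x - B ν x * Lam x -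
          Ring.inverse (fderiv ℝ exp (B ν x)) (exp (B ν x) * (Lam (x + e ν) - Lam x)))) 0 U V) by simp [hev],
      ← clm_fderiv_fderiv_comp_apply ev hX2 U V]
    simp [hev]
  rw [hcomp]
  -- the linear part has vanishing second derivative
  set L : (Λ → T → 𝔄) →L[ℝ] 𝔄 := Lam x • ev - MulOpposite.op (Lam x) • ev with hL
  have hLf : (fun B : Λ → T → 𝔄 => Lam x * ev B - ev B * Lam x) = L := by
    funext B
    simp [hL]
  have hA : ContDiff ℝ 2 (fun B : Λ → T → 𝔄 => Lam x * ev B - ev B * Lam x) := by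
    rw [hLf]
    exact L.contDiff
  have hA2 : fderiv ℝ (fderiv ℝ (fun B : Λ → T → 𝔄 => Lam x * ev B - ev B * Lam x)) 0 U V = 0 := by
    rw [hLf, show fderiv ℝ (⇑L) = fun _ => L from funext fun _ => L.fderiv]
    simp
  -- the non-linear part is `ζ ∘ ev`
  have hζ2 : ContDiffAt ℝ 2 (fun b : 𝔄 => Ring.inverse (fderiv ℝ exp b) (exp b * (Lam (x + e ν) - Lam x)))
      (ev 0) := by
    rw [map_zero]
    exact contDiffAt_inverse_fderiv_exp_apply (n := 2) (by rw [fderiv_exp_zero]; exact isUnit_one) _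
  have hZ : ContDiffAt ℝ 2 (fun B : Λ → T → 𝔄 =>
      Ring.inverse (fderiv ℝ exp (ev B)) (exp (ev B) * (Lam (x + e ν) - Lam x))) 0 :=
    hζ2.comp 0 ev.contDiff.contDiffAt
  rw [fderiv_fderiv_sub_apply hA.contDiffAt hZ U V, hA2, fderiv_fderiv_comp_clm_apply ev hζ2 U V, map_zero,
    fderiv_fderiv_inverse_fderiv_exp_apply_zero, zero_sub]
  simp [hev]

end SecondJetField

/-! ## §8. Print's route from (4.9) at `B ≠ 0`: (4.10), (4.11) for all small `B`; (4.13) and (4.11)|₀ at `B = 0` -/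

section PrintsRoute

variable {𝔄 : Type*} [NormedRing 𝔄] [NormedAlgebra ℝ 𝔄] [CompleteSpace 𝔄] {Λ T : Type*} [Fintype Λ] [Fintype T]
  [AddCommGroup T] {F : Type*} [NormedAddCommGroup F] [NormedSpace ℝ F]

/-- **(4.10) for all small `B`** (p. 283 «From this we derive a whole sequence of identities by differentiations
with respect to B.» (4.10) «⟨(δ²/δB²)𝐄(exp iB), iad_{λ₋}B − g⁻¹(iad_B)∂λ, B₁⟩ + ⟨(δ/δB)𝐄(exp iB), iad_{λ₋}B₁ −
½iad_{B₁}∂λ − k₂{iad_{B₁}, iad_B}∂λ − …⟩ = 0»), with print's «…» made EXACT: for every configuration `A` near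
`0` and every `B₁`, `D²f(A)(B₁, X_λ(A)) + Df(A)[DX_λ(A)B₁] = 0`, `f(B) = 𝐄(exp iB)`, `X_λ` the generator field of
§5 (`…B12Ward414.ward_first_order_eventually` fed with `hinv` = `fderiv_chart_apply_gaugeGen_eq_zero_eventually`).
[cite: Balaban1987RG1, (4.7) p.282, (4.9)-(4.10) p.283] -/
theorem ward_first_order_gaugeGen_eventually {ℰ : (Λ → T → 𝔄) → F} (e : Λ → T) (Lam : T → 𝔄)
    (hℰ : ∀ᶠ W in 𝓝 (1 : Λ → T → 𝔄), ContDiffAt ℝ 2 ℰ W)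
    (h47 : ∀ᶠ W in 𝓝 (1 : Λ → T → 𝔄), ∀ᶠ t in 𝓝 (0 : ℝ),
      ℰ (fun ν x => exp (t • Lam x) * W ν x * exp (-(t • Lam (x + e ν)))) = ℰ W) :
    ∀ᶠ A in 𝓝 (0 : Λ → T → 𝔄), ∀ U : Λ → T → 𝔄,
      fderiv ℝ (fderiv ℝ (fun B : Λ → T → 𝔄 => ℰ (fun ν x => exp (B ν x)))) A U
          ((fun B : Λ → T → 𝔄 => fun ν x => Lam x * B ν x - B ν x * Lam x -
            Ring.inverse (fderiv ℝ exp (B ν x)) (exp (B ν x) * (Lam (x + e ν) - Lam x))) A) +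
        fderiv ℝ (fun B : Λ → T → 𝔄 => ℰ (fun ν x => exp (B ν x))) A
          (fderiv ℝ (fun B : Λ → T → 𝔄 => fun ν x => Lam x * B ν x - B ν x * Lam x -
            Ring.inverse (fderiv ℝ exp (B ν x)) (exp (B ν x) * (Lam (x + e ν) - Lam x))) A U) = 0 := by
  have hc : Tendsto (fun B : Λ → T → 𝔄 => fun ν x => exp (B ν x)) (𝓝 0) (𝓝 1) := by
    have h := (contDiff_expChart (𝔄 := 𝔄) (Λ := Λ) (T := T) (n := 0)).continuous.tendsto 0
    rwa [expChart_zero] at h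
  have hf : ∀ᶠ A in 𝓝 (0 : Λ → T → 𝔄), ContDiffAt ℝ 2 (fun B : Λ → T → 𝔄 => ℰ (fun ν x => exp (B ν x))) A := by
    filter_upwards [hc.eventually hℰ] with A hA
    exact hA.comp A (contDiff_expChart (n := 2)).contDiffAt
  have hdiff : ∀ᶠ W in 𝓝 (1 : Λ → T → 𝔄), DifferentiableAt ℝ ℰ W :=
    hℰ.mono fun W hW => hW.differentiableAt (by simp)
  exact ward_first_order_eventually (𝕜 := ℝ) hf
    ((contDiffAt_gaugeGen_eventually (n := 1) e Lam).mono fun A hA => hA.differentiableAt (by simp))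
    (fderiv_chart_apply_gaugeGen_eq_zero_eventually e Lam hdiff h47)

/-- **(4.13) at `B = 0` BY PRINT'S ROUTE** (p. 284 «Consider at first (4.10) at B = 0: ⟨(δ²/δB²)𝐄(1), −∂λ, B₁⟩ +
⟨(δ/δB)𝐄(1), iad_{λ₋}B₁ − ½iad_{B₁}∂λ⟩ = 0»): for `f(B) = 𝐄(exp iB)` on ambient bond fields,
`D²f(0)(B₁, −∂Λ) + Df(0)[[Λ₋, B₁] − ½[B₁, ∂Λ]] = 0` — (4.10) at `B = 0` with the jets `X_λ(0) = −∂λ`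
(`gaugeGen_zero`) and `DX_λ(0)B₁ = [Λ₋, B₁] − ½[B₁, ∂Λ]` (`fderiv_gaugeGen_zero_apply`), the coefficient `½` of
`g⁻¹` now COMPUTED rather than read off print (`…B12Ward414.ward_first_order`).  Cross-check: the lineage's ambient
route gives the same identity (`…B12Semisimple414.hessian_one_apply_grad_eq` with `ward_plus_jordan_eq_half_
commutators`). [cite: Balaban1987RG1, (4.7) p.282, (4.9)-(4.10) p.283, (4.13) p.284] -/
theorem ward_first_order_gaugeGen_zero {ℰ : (Λ → T → 𝔄) → F} (e : Λ → T) (Lam : T → 𝔄)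
    (hℰ : ContDiffAt ℝ 2 ℰ 1)
    (h47 : ∀ᶠ W in 𝓝 (1 : Λ → T → 𝔄), ∀ᶠ t in 𝓝 (0 : ℝ),
      ℰ (fun ν x => exp (t • Lam x) * W ν x * exp (-(t • Lam (x + e ν)))) = ℰ W) (U : Λ → T → 𝔄) :
    fderiv ℝ (fderiv ℝ (fun B : Λ → T → 𝔄 => ℰ (fun ν x => exp (B ν x)))) 0 U
        (fun ν x => -(Lam (x + e ν) - Lam x)) +
      fderiv ℝ (fun B : Λ → T → 𝔄 => ℰ (fun ν x => exp (B ν x))) 0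
        (fun ν x => Lam x * U ν x - U ν x * Lam x -
          (2 : ℝ)⁻¹ • (U ν x * (Lam (x + e ν) - Lam x) - (Lam (x + e ν) - Lam x) * U ν x)) = 0 := by
  have hf : ContDiffAt ℝ 2 (fun B : Λ → T → 𝔄 => ℰ (fun ν x => exp (B ν x))) 0 := by
    have h1 : ContDiffAt ℝ 2 ℰ ((fun B : Λ → T → 𝔄 => fun ν x => exp (B ν x)) 0) := by
      rwa [show ((fun B : Λ → T → 𝔄 => fun ν x => exp (B ν x)) 0) = 1 from expChart_zero]
    exact h1.comp 0 (contDiff_expChart (n := 2)).contDiffAt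
  have hdiff : ∀ᶠ W in 𝓝 (1 : Λ → T → 𝔄), DifferentiableAt ℝ ℰ W := by
    filter_upwards [hℰ.eventually (by simp)] with W hW
    exact hW.differentiableAt (by simp)
  have h := ward_first_order (𝕜 := ℝ) hf ((contDiffAt_gaugeGen_zero (n := 1) e Lam).differentiableAt (by simp))
    (fderiv_chart_apply_gaugeGen_eq_zero_eventually e Lam hdiff h47) U
  rwa [gaugeGen_zero, fderiv_gaugeGen_zero_apply] at h

/-- **(4.11) for all small `B`** (p. 283 (4.11) «⟨(δ³/δB³)𝐄(exp iB), iad_{λ₋}B − g⁻¹(iad_B)∂λ, B₁, B₂⟩ +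
⟨(δ²/δB²)𝐄(exp iB), iad_{λ₋}B₂ − ½iad_{B₂}∂λ − k₂{iad_{B₂}, iad_B}∂λ − …, B₁⟩ + (B₁↔B₂) + ⟨(δ/δB)𝐄(exp iB),
−k₂{iad_{B₁}, iad_{B₂}}∂λ − …⟩ = 0,» — the verbatim (4.11) of the module header; print's «(B₁↔B₂)» is the term
`D²f(A)(B₂, DX_λ(A)B₁)` below), with print's «…» made EXACT: for every configuration `A` near `0`,
`D³f(A)(B₁, B₂, X_λ(A)) + D²f(A)(B₁, DX_λ(A)B₂) + D²f(A)(B₂, DX_λ(A)B₁) + Df(A)[D²X_λ(A)(B₁, B₂)] = 0`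
(`…B12Ward414.ward_second_order_eventually` fed with `hinv`). [cite: Balaban1987RG1, (4.7) p.282, (4.9)/(4.11)
p.283] (v1.0.1 DOCFIX D1 of XREAD C-pv23g10-7: the v1 docstring carried a paraphrase of (4.11) inside guillemets;
declaration unchanged.) -/
theorem ward_second_order_gaugeGen_eventually {ℰ : (Λ → T → 𝔄) → F} (e : Λ → T) (Lam : T → 𝔄)
    (hℰ : ∀ᶠ W in 𝓝 (1 : Λ → T → 𝔄), ContDiffAt ℝ 3 ℰ W)
    (h47 : ∀ᶠ W in 𝓝 (1 : Λ → T → 𝔄), ∀ᶠ t in 𝓝 (0 : ℝ),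
      ℰ (fun ν x => exp (t • Lam x) * W ν x * exp (-(t • Lam (x + e ν)))) = ℰ W) (U V : Λ → T → 𝔄) :
    ∀ᶠ A in 𝓝 (0 : Λ → T → 𝔄),
      fderiv ℝ (fderiv ℝ (fderiv ℝ (fun B : Λ → T → 𝔄 => ℰ (fun ν x => exp (B ν x))))) A U V
          ((fun B : Λ → T → 𝔄 => fun ν x => Lam x * B ν x - B ν x * Lam x -
            Ring.inverse (fderiv ℝ exp (B ν x)) (exp (B ν x) * (Lam (x + e ν) - Lam x))) A) +
        fderiv ℝ (fderiv ℝ (fun B : Λ → T → 𝔄 => ℰ (fun ν x => exp (B ν x)))) A U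
          (fderiv ℝ (fun B : Λ → T → 𝔄 => fun ν x => Lam x * B ν x - B ν x * Lam x -
            Ring.inverse (fderiv ℝ exp (B ν x)) (exp (B ν x) * (Lam (x + e ν) - Lam x))) A V) +
        fderiv ℝ (fderiv ℝ (fun B : Λ → T → 𝔄 => ℰ (fun ν x => exp (B ν x)))) A V
          (fderiv ℝ (fun B : Λ → T → 𝔄 => fun ν x => Lam x * B ν x - B ν x * Lam x -
            Ring.inverse (fderiv ℝ exp (B ν x)) (exp (B ν x) * (Lam (x + e ν) - Lam x))) A U) +
        fderiv ℝ (fun B : Λ → T → 𝔄 => ℰ (fun ν x => exp (B ν x))) A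
          (fderiv ℝ (fderiv ℝ (fun B : Λ → T → 𝔄 => fun ν x => Lam x * B ν x - B ν x * Lam x -
            Ring.inverse (fderiv ℝ exp (B ν x)) (exp (B ν x) * (Lam (x + e ν) - Lam x)))) A U V) = 0 := by
  have hc : Tendsto (fun B : Λ → T → 𝔄 => fun ν x => exp (B ν x)) (𝓝 0) (𝓝 1) := by
    have h := (contDiff_expChart (𝔄 := 𝔄) (Λ := Λ) (T := T) (n := 0)).continuous.tendsto 0
    rwa [expChart_zero] at h
  have hf : ∀ᶠ A in 𝓝 (0 : Λ → T → 𝔄), ContDiffAt ℝ 3 (fun B : Λ → T → 𝔄 => ℰ (fun ν x => exp (B ν x))) A := by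
    filter_upwards [hc.eventually hℰ] with A hA
    exact hA.comp A (contDiff_expChart (n := 3)).contDiffAt
  have hdiff : ∀ᶠ W in 𝓝 (1 : Λ → T → 𝔄), DifferentiableAt ℝ ℰ W :=
    hℰ.mono fun W hW => hW.differentiableAt (by simp)
  exact ward_second_order_eventually (𝕜 := ℝ) hf (contDiffAt_gaugeGen_eventually (n := 2) e Lam)
    (fderiv_chart_apply_gaugeGen_eq_zero_eventually e Lam hdiff h47) U V

/-- **(4.11) at `B = 0` BY PRINT'S ROUTE, `k₂ = 1/12` included** (locator: (4.11) at `B = 0` = the second identity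
of (4.15), p. 284, before (4.14) is applied — print p. 284: «We obtain the following set of Ward-Takahashi
identities» (4.15); v1.0.1 DOCFIX D2 of XREAD C-pv23g10-7: the v1 docstring's «Let us write (4.11) for B = 0» is
not a sentence of p. 284; declaration unchanged): for
`f(B) = 𝐄(exp iB)`, `D³f(0)(B₁, B₂, −∂Λ) + D²f(0)(B₁, c(B₂)) + D²f(0)(B₂, c(B₁)) − Df(0)[(1/12)({ad_{B₁},
ad_{B₂}}∂Λ)_b] = 0` with `c(U) = ([Λ₋, U] − ½[U, ∂Λ])_b` — (4.11) at `0` with ALL THREE JETS of the constructed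
generator substituted (`gaugeGen_zero`, `fderiv_gaugeGen_zero_apply`, `fderiv_fderiv_gaugeGen_zero_apply`).
Cross-check: `…B12WardSecond415` obtained the same identity in ambient `ρ`-coordinates from (4.7) directly, reading
`k₂ = 1/12` off the cubic Taylor coefficient; here `1/12` is the second jet of `g⁻¹(ad)`. [cite: Balaban1987RG1,
(4.9)/(4.11) p.283, p.284] -/
theorem ward_second_order_gaugeGen_zero {ℰ : (Λ → T → 𝔄) → F} (e : Λ → T) (Lam : T → 𝔄)
    (hℰ : ContDiffAt ℝ 3 ℰ 1)
    (h47 : ∀ᶠ W in 𝓝 (1 : Λ → T → 𝔄), ∀ᶠ t in 𝓝 (0 : ℝ),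
      ℰ (fun ν x => exp (t • Lam x) * W ν x * exp (-(t • Lam (x + e ν)))) = ℰ W) (U V : Λ → T → 𝔄) :
    fderiv ℝ (fderiv ℝ (fderiv ℝ (fun B : Λ → T → 𝔄 => ℰ (fun ν x => exp (B ν x))))) 0 U V
        (fun ν x => -(Lam (x + e ν) - Lam x)) +
      fderiv ℝ (fderiv ℝ (fun B : Λ → T → 𝔄 => ℰ (fun ν x => exp (B ν x)))) 0 U
        (fun ν x => Lam x * V ν x - V ν x * Lam x -
          (2 : ℝ)⁻¹ • (V ν x * (Lam (x + e ν) - Lam x) - (Lam (x + e ν) - Lam x) * V ν x)) +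
      fderiv ℝ (fderiv ℝ (fun B : Λ → T → 𝔄 => ℰ (fun ν x => exp (B ν x)))) 0 V
        (fun ν x => Lam x * U ν x - U ν x * Lam x -
          (2 : ℝ)⁻¹ • (U ν x * (Lam (x + e ν) - Lam x) - (Lam (x + e ν) - Lam x) * U ν x)) +
      fderiv ℝ (fun B : Λ → T → 𝔄 => ℰ (fun ν x => exp (B ν x))) 0
        (fun ν x => -((12 : ℝ)⁻¹ • ((V ν x * (U ν x * (Lam (x + e ν) - Lam x) - (Lam (x + e ν) - Lam x) * U ν x) -
            (U ν x * (Lam (x + e ν) - Lam x) - (Lam (x + e ν) - Lam x) * U ν x) * V ν x) +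
          (U ν x * (V ν x * (Lam (x + e ν) - Lam x) - (Lam (x + e ν) - Lam x) * V ν x) -
            (V ν x * (Lam (x + e ν) - Lam x) - (Lam (x + e ν) - Lam x) * V ν x) * U ν x)))) = 0 := by
  have hf : ContDiffAt ℝ 3 (fun B : Λ → T → 𝔄 => ℰ (fun ν x => exp (B ν x))) 0 := by
    have h1 : ContDiffAt ℝ 3 ℰ ((fun B : Λ → T → 𝔄 => fun ν x => exp (B ν x)) 0) := by
      rwa [show ((fun B : Λ → T → 𝔄 => fun ν x => exp (B ν x)) 0) = 1 from expChart_zero]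
    exact h1.comp 0 (contDiff_expChart (n := 3)).contDiffAt
  have hdiff : ∀ᶠ W in 𝓝 (1 : Λ → T → 𝔄), DifferentiableAt ℝ ℰ W := by
    filter_upwards [hℰ.eventually (by simp)] with W hW
    exact hW.differentiableAt (by simp)
  have h := ward_second_order (𝕜 := ℝ) hf (contDiffAt_gaugeGen_zero (n := 2) e Lam)
    (fderiv_chart_apply_gaugeGen_eq_zero_eventually e Lam hdiff h47) U V
  rwa [gaugeGen_zero, fderiv_gaugeGen_zero_apply, fderiv_gaugeGen_zero_apply, fderiv_fderiv_gaugeGen_zero_apply]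
    at h

end PrintsRoute

end Literature.MathematicalPhysics.QuantumFieldTheory.Balaban1983to89.B12GaugeGen48
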